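import Mathlib.Analysis.InnerProductSpace.Calculus
import Mathlib.Analysis.Calculus.Deriv.Star
import Mathlib.Analysis.Calculus.Deriv.Inv
import Mathlib.Analysis.Calculus.Deriv.Prod
import Mathlib.Analysis.Calculus.Deriv.MeanValue
import Mathlib.Analysis.Calculus.MeanValue
import Mathlib.Analysis.SpecialFunctions.ExpDeriv
import Mathlib.Analysis.SpecialFunctions.Log.Deriv
import Mathlib.Data.Matrix.Basic
import HarnessLib

/-!
# Slaving of the fast components to a weakly coupled slow mode: the one-column Riccati
# (Chang / Hartman–Wintner) decoupling with explicit finite-time constants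

Topic `Literature/Analysis/ODE` (namespace `Literature.Analysis.ODE`). Everything here is PROVED (no
definition, no named fact).

## Setting (finite-dimensional, any index type `ι`; the shape of the ladder files of cell `ad-ideate`)

A trajectory `v : ℝ → ι → ℂ`, continuous on `[a, b]`, of the non-autonomous linear system
`v' = −Λ (D v + g(s) S v)` on `(a, b)`, with a rate `Λ > 0`, `D = diag d` real, `S` a complex
SKEW-HERMITIAN matrix (`S K J = −conj (S J K)`), and a real coupling `g` with `|g(s)| ≤ g_T` (no sign, no
monotonicity, no derivative of `g` is ever used). A distinguished SLOW index `o` is separated from the other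
("fast") indices by a spectral gap `d J ≥ d o + Δ` (`J ≠ o`), and `γ² := Σ_{K ≠ o} ‖S o K‖²` measures the
coupling of the slow mode to the rest.

## Results

* `hasDerivAt_energy`, `hasDerivAt_slowEnergy` — the two exact identities behind everything: along the field,
  `(Σ_J ‖v_J‖²)' = −2Λ Σ_J d_J ‖v_J‖²` (the skew exchange is invisible in the energy) and
  `(‖v_o‖²)' = −2Λ (d_o ‖v_o‖² + g·Re(conj(v_o) Σ_{K≠o} S_{oK} v_K))` (the diagonal entry `S o o ∈ iℝ` drops out).
* `slowCone_invariant` — **SLAVING (invariant cone).** If `0 < R` and `g_T γ (1 + R²) < Δ R` (e.g.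
  `R = 2 g_T γ / Δ` when `2 g_T γ < Δ`, `slowCone_radius_two_mul`), then the cone
  `Σ_{J≠o} ‖v_J‖² ≤ R² ‖v_o‖²` is forward invariant along every trajectory entering it strictly, and `v_o`
  never vanishes. (Contact-point argument: on the boundary of the cone the defect has derivative
  `2ΛR‖v_o‖²(g_Tγ(1+R²) − ΔR) < 0`; positivity of `‖v_o‖` from a backward energy bound.)
* `hasDerivAt_log_slowEnergy` — **EXACT SLOW LAW.** With the ratios `w_K := v_K / v_o`,
  `(log ‖v_o‖²)' = −2Λ (d_o + g·Re Σ_{K≠o} S_{oK} w_K)`; hence the crude two-sided law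
  `|log ‖v_o(s)‖² − log ‖v_o(a)‖² + 2Λ d_o (s − a)| ≤ 2Λ g_T γ R (s − a)` (`abs_log_slowEnergy_sub_le`).
* `hasDerivAt_ratio` — the ratios solve the (projective) RICCATI equation
  `w_J' = −Λ((d_J − d_o) w_J + g (S w)_J − g w_J (S w)_o)`.
* `ratio_remainder_le` — **FIRST-ORDER (Hartman–Wintner) EXPANSION with explicit remainder.** For ANY family
  `ρ_J` (`J ≠ o`) solving the decoupled linear equations `ρ_J' = −Λ((d_J − d_o) ρ_J + g S_{Jo})` with
  `ρ_J(a) = w_J(a)` — e.g. Duhamel responses of `g`, `hasDerivAt_duhamelMode` — one has, uniformly on `[a,b]`,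
  `Σ_{J≠o} ‖w_J − ρ_J‖² ≤ Q²`, `Q := g_T R (σ + ‖S o o‖ + γ R)/Δ`, where `σ` bounds the fast–fast block of `S`
  in operator norm (`ratio_remainder_le`) or through its row sums (Schur test, `ratio_remainder_le_of_rowSum`).
* `abs_log_slowEnergy_expansion_le` — **THE TWO-SIDED SLOW LAW TO SECOND ORDER**: for any primitive `Φ` of
  `g·Re Σ_{K≠o} S_{oK} ρ_K`,
  `|log ‖v_o(s)‖² − log ‖v_o(a)‖² + 2Λ d_o (s − a) + 2Λ (Φ s − Φ a)| ≤ 2Λ g_T γ Q (s − a)`;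
  and `re_sum_mul_duhamelMode` identifies the exponent for Duhamel responses `ρ_K = −Λ S_{Ko} j_K`
  (`j_K` real): `Re Σ_{K≠o} S_{oK} ρ_K = Λ Σ_{K≠o} ‖S_{oK}‖² j_K` — a positive combination of the
  `λ∫ a·J`-type double integrals of `Literature.Analysis.FluidPDE.QuasiStaticSlotWeight` (rates `λ = Λ(d_K − d_o)`).

* `norm_slow_le_of_gap`, `sqrt_fast_le_of_gap` — **THE OTHER COLUMNS** (data off the cone, e.g. purely fast
  data; needs `d_o ≥ 0`): the fast part feeds the slow mode by at most `g_T γ/Δ` of its size and then relaxes at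
  the gap rate to the slaved level, while the slow mode grows at most at the Taylor rate `Λ g_T² γ²/Δ`:
  `‖v_o(s)‖ ≤ e^{Λ g_T²γ²(s−a)/Δ}(‖v_o(a)‖ + (g_Tγ/Δ)√Z(a))` and
  `√Z(s) ≤ e^{−ΛΔ(s−a)}√Z(a) + (g_Tγ/Δ)·e^{Λ g_T²γ²(s−a)/Δ}(‖v_o(a)‖ + (g_Tγ/Δ)√Z(a))`, `Z = Σ_{J≠o}‖v_J‖²`
  (comparison for the regularised amplitudes `√(θ² + ·)`, `θ ↓ 0`).

* `eq_of_eq_init`, `eq_add_of_init` — forward UNIQUENESS and SUPERPOSITION for the linear system (any real `d`,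
  any `g`): a datum splits into its slow column and its fast part, to which the two groups of bounds apply.
* `hasDerivAt_field_conj`, `conj_eq_of_conj_init`, `slow_eq_norm_of_real` — REAL couplings: conjugation symmetry,
  real data stay real, and the slow entry of the real column is real POSITIVE (`v_o(s) = ‖v_o(s)‖`): slot
  multipliers carry no phase.

All constants depend only on `(Λ, Δ, g_T, γ, σ, ‖S o o‖, R)`, never on `ι` — this is the point for Galerkin
truncations (uniformity in the truncation).

## Provenance

This is the one-column (projective) form of the classical Riccati decoupling of slow–fast LINEAR time-varying
systems: K. W. Chang's bounded solution `L(t)` of the Riccati equation `εL̇ = DL − εLA + εLBL − C`, which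
block-diagonalises the system exactly [cite: KokotovicBensoussanBlankenship1987, Kokotović «Singular perturbation techniques in control theory» §2 eq. (2.29), Thm 2.3]
[cite: Chang1972], and of the Hartman–Wintner / Harris–Lutz transformation `Y = (I + Q)Z`,
`Q' = ΛQ − QΛ + R̃`, whose first-order solution is the Duhamel response used in `ratio_remainder_le`
[cite: Eastham1989, §1.5 (1.5.2), (1.5.9), Thm 1.5.1]. The printed theorems are asymptotic (`x → ∞`,
`R ∈ Lᵖ`); here the interval is finite and every constant is explicit, which is what a cell-problem
bookkeeping needs. Deliberately NOT here: any identification with a concrete Galerkin system (see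
`Literature.Analysis.ODE.SlowColumnSlavingIntWindow` for the three-term-ladder form) and products over
consecutive time slots.
-/

noncomputable section

namespace Literature.Analysis.ODE

open Set Finset Complex Filter
open scoped BigOperators ComplexConjugate Topology

/-! ## §0 Elementary algebra -/

/-- Cauchy–Schwarz for a finite complex bilinear sum, squared form. [folklore] -/
private theorem norm_sum_mul_sq_le' {ι : Type*} (s : Finset ι) (f w : ι → ℂ) :
    ‖∑ J ∈ s, f J * w J‖ ^ 2 ≤ (∑ J ∈ s, ‖f J‖ ^ 2) * ∑ J ∈ s, ‖w J‖ ^ 2 := by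
  have h1 : ‖∑ J ∈ s, f J * w J‖ ≤ ∑ J ∈ s, ‖f J‖ * ‖w J‖ :=
    (norm_sum_le _ _).trans (Finset.sum_le_sum fun J _ => (norm_mul_le _ _))
  exact (pow_le_pow_left₀ (norm_nonneg _) h1 2).trans (Finset.sum_mul_sq_le_sq_mul_sq s _ _)

/-- Cauchy–Schwarz, square-root form: `‖Σ f w‖ ≤ √(Σ‖f‖²) · √(Σ‖w‖²)`. [folklore] -/
private theorem norm_sum_mul_le_sqrt {ι : Type*} (s : Finset ι) (f w : ι → ℂ) :
    ‖∑ J ∈ s, f J * w J‖ ≤ Real.sqrt (∑ J ∈ s, ‖f J‖ ^ 2) * Real.sqrt (∑ J ∈ s, ‖w J‖ ^ 2) := by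
  have h := norm_sum_mul_sq_le' s f w
  have hA : 0 ≤ ∑ J ∈ s, ‖f J‖ ^ 2 := Finset.sum_nonneg fun J _ => by positivity
  have hB : 0 ≤ ∑ J ∈ s, ‖w J‖ ^ 2 := Finset.sum_nonneg fun J _ => by positivity
  rw [← Real.sqrt_mul hA, ← Real.sqrt_sq (norm_nonneg (∑ J ∈ s, f J * w J))]
  exact Real.sqrt_le_sqrt h

/-- Real Cauchy–Schwarz: `Σ a b ≤ √(Σ a²) √(Σ b²)`. [folklore] -/
private theorem sum_mul_le_sqrt {ι : Type*} (s : Finset ι) (x y : ι → ℝ) :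
    ∑ J ∈ s, x J * y J ≤ Real.sqrt (∑ J ∈ s, x J ^ 2) * Real.sqrt (∑ J ∈ s, y J ^ 2) := by
  have h := Finset.sum_mul_sq_le_sq_mul_sq s x y
  have hA : 0 ≤ ∑ J ∈ s, x J ^ 2 := Finset.sum_nonneg fun J _ => by positivity
  calc ∑ J ∈ s, x J * y J ≤ |∑ J ∈ s, x J * y J| := le_abs_self _
    _ = Real.sqrt ((∑ J ∈ s, x J * y J) ^ 2) := (Real.sqrt_sq_eq_abs _).symm
    _ ≤ Real.sqrt ((∑ J ∈ s, x J ^ 2) * ∑ J ∈ s, y J ^ 2) := Real.sqrt_le_sqrt h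
    _ = Real.sqrt (∑ J ∈ s, x J ^ 2) * Real.sqrt (∑ J ∈ s, y J ^ 2) := Real.sqrt_mul hA _

/-- For a skew-Hermitian `S`, the exchange term is purely imaginary: `Re Σ_J conj(v_J) (S v)_J = 0`.
[folklore] -/
private theorem re_sum_conj_mul_mulVec_eq_zero {ι : Type*} [Fintype ι] (S : Matrix ι ι ℂ)
    (hS : ∀ J K, S K J = -conj (S J K)) (v : ι → ℂ) :
    (∑ J, conj (v J) * ∑ K, S J K * v K).re = 0 := by
  set A : ℂ := ∑ J, conj (v J) * ∑ K, S J K * v K with hA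
  have hconj : ∀ J K, conj (S J K) = -S K J := fun J K => by rw [hS J K, neg_neg]
  have h1 : conj A = ∑ J, ∑ K, v J * (conj (S J K) * conj (v K)) := by
    simp only [hA, map_sum, map_mul, Complex.conj_conj, Finset.mul_sum]
  have h2 : ∑ J, ∑ K, v J * (conj (S J K) * conj (v K)) = ∑ J, ∑ K, -(conj (v K) * (S K J * v J)) := by
    refine Finset.sum_congr rfl fun J _ => Finset.sum_congr rfl fun K _ => ?_
    rw [hconj J K]
    ring
  have h3 : ∑ J, ∑ K, -(conj (v K) * (S K J * v J)) = -A := by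
    rw [Finset.sum_comm]
    simp only [Finset.sum_neg_distrib, hA, Finset.mul_sum]
  have h4 : (conj A).re = (-A).re := by rw [h1, h2, h3]
  rw [Complex.conj_re, Complex.neg_re] at h4
  linarith

/-- A skew-Hermitian matrix has purely imaginary diagonal: `Re (S o o) = 0`. [folklore] -/
private theorem re_diag_eq_zero_of_skew {ι : Type*} (S : Matrix ι ι ℂ)
    (hS : ∀ J K, S K J = -conj (S J K)) (o : ι) : (S o o).re = 0 := by
  have h := congrArg Complex.re (hS o o)
  rw [Complex.neg_re, Complex.conj_re] at h
  linarith

/-- Splitting the slow row: `conj(v_o)·(S v)_o` has real part `Re(conj(v_o) Σ_{K≠o} S_{oK} v_K)` (the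
diagonal term `S_{oo}|v_o|²` is purely imaginary). [folklore] -/
private theorem re_conj_mul_row_eq {ι : Type*} [Fintype ι] [DecidableEq ι] (S : Matrix ι ι ℂ)
    (hS : ∀ J K, S K J = -conj (S J K)) (o : ι) (v : ι → ℂ) :
    (conj (v o) * ∑ K, S o K * v K).re = (conj (v o) * ∑ K ∈ univ.erase o, S o K * v K).re := by
  rw [← Finset.add_sum_erase _ _ (Finset.mem_univ o), mul_add, Complex.add_re]
  have h0 : (conj (v o) * (S o o * v o)).re = 0 := by
    have : conj (v o) * (S o o * v o) = S o o * (conj (v o) * v o) := by ring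
    rw [this, Complex.conj_mul', ← Complex.ofReal_pow, Complex.re_mul_ofReal, re_diag_eq_zero_of_skew S hS o,
      zero_mul]
  rw [h0, zero_add]

/-- Schur test for the fast–fast block: if every row and every column of `(S J K)_{J,K ≠ o}` has `ℓ¹`-norm
at most `σ`, then the block has `ℓ²`-operator norm at most `σ` (Schur test). [folklore] -/
private theorem sum_norm_sq_block_le_of_rowSum {ι : Type*} [Fintype ι] [DecidableEq ι] (S : Matrix ι ι ℂ)
    (o : ι) (σ : ℝ) (hrow : ∀ J, J ≠ o → ∑ K ∈ univ.erase o, ‖S J K‖ ≤ σ)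
    (hcol : ∀ K, K ≠ o → ∑ J ∈ univ.erase o, ‖S J K‖ ≤ σ) (x : ι → ℂ) :
    ∑ J ∈ univ.erase o, ‖∑ K ∈ univ.erase o, S J K * x K‖ ^ 2 ≤
      σ ^ 2 * ∑ K ∈ univ.erase o, ‖x K‖ ^ 2 := by
  set T := (univ : Finset ι).erase o with hT
  -- `|(Sx)_J|² ≤ (Σ_K |S_JK|) (Σ_K |S_JK| |x_K|²) ≤ σ Σ_K |S_JK| |x_K|²`
  have hσ0 : ∀ J ∈ T, 0 ≤ σ := fun J hJ =>
    le_trans (Finset.sum_nonneg fun K _ => norm_nonneg _) (hrow J (Finset.ne_of_mem_erase hJ))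
  have h1 : ∀ J ∈ T, ‖∑ K ∈ T, S J K * x K‖ ^ 2 ≤ σ * ∑ K ∈ T, ‖S J K‖ * ‖x K‖ ^ 2 := by
    intro J hJ
    have hn : ‖∑ K ∈ T, S J K * x K‖ ≤ ∑ K ∈ T, ‖S J K‖ * ‖x K‖ :=
      (norm_sum_le _ _).trans (Finset.sum_le_sum fun K _ => (norm_mul_le _ _))
    have hcs : (∑ K ∈ T, ‖S J K‖ * ‖x K‖) ^ 2 ≤ (∑ K ∈ T, ‖S J K‖) * ∑ K ∈ T, ‖S J K‖ * ‖x K‖ ^ 2 := by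
      have := Finset.sum_mul_sq_le_sq_mul_sq T (fun K => Real.sqrt ‖S J K‖) (fun K => Real.sqrt ‖S J K‖ * ‖x K‖)
      have e1 : ∀ K ∈ T, Real.sqrt ‖S J K‖ * (Real.sqrt ‖S J K‖ * ‖x K‖) = ‖S J K‖ * ‖x K‖ := by
        intro K _
        rw [← mul_assoc, Real.mul_self_sqrt (norm_nonneg _)]
      have e2 : ∀ K ∈ T, Real.sqrt ‖S J K‖ ^ 2 = ‖S J K‖ := fun K _ => Real.sq_sqrt (norm_nonneg _)
      have e3 : ∀ K ∈ T, (Real.sqrt ‖S J K‖ * ‖x K‖) ^ 2 = ‖S J K‖ * ‖x K‖ ^ 2 := by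
        intro K _
        rw [mul_pow, Real.sq_sqrt (norm_nonneg _)]
      rw [Finset.sum_congr rfl e1, Finset.sum_congr rfl e2, Finset.sum_congr rfl e3] at this
      exact this
    have hB : 0 ≤ ∑ K ∈ T, ‖S J K‖ * ‖x K‖ ^ 2 := Finset.sum_nonneg fun K _ => by positivity
    calc ‖∑ K ∈ T, S J K * x K‖ ^ 2 ≤ (∑ K ∈ T, ‖S J K‖ * ‖x K‖) ^ 2 :=
          pow_le_pow_left₀ (norm_nonneg _) hn 2
      _ ≤ (∑ K ∈ T, ‖S J K‖) * ∑ K ∈ T, ‖S J K‖ * ‖x K‖ ^ 2 := hcs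
      _ ≤ σ * ∑ K ∈ T, ‖S J K‖ * ‖x K‖ ^ 2 :=
          mul_le_mul_of_nonneg_right (hrow J (Finset.ne_of_mem_erase hJ)) hB
  calc ∑ J ∈ T, ‖∑ K ∈ T, S J K * x K‖ ^ 2 ≤ ∑ J ∈ T, σ * ∑ K ∈ T, ‖S J K‖ * ‖x K‖ ^ 2 :=
        Finset.sum_le_sum h1
    _ = σ * ∑ K ∈ T, (∑ J ∈ T, ‖S J K‖) * ‖x K‖ ^ 2 := by
        rw [← Finset.mul_sum, Finset.sum_comm]
        congr 1
        refine Finset.sum_congr rfl fun K _ => ?_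
        rw [Finset.sum_mul]
    _ ≤ σ * ∑ K ∈ T, σ * ‖x K‖ ^ 2 := by
        by_cases hT0 : T.Nonempty
        · obtain ⟨J, hJ⟩ := hT0
          refine mul_le_mul_of_nonneg_left (Finset.sum_le_sum fun K hK => ?_) (hσ0 J hJ)
          exact mul_le_mul_of_nonneg_right (hcol K (Finset.ne_of_mem_erase hK)) (by positivity)
        · rw [Finset.not_nonempty_iff_eq_empty] at hT0
          simp [hT0]
    _ = σ ^ 2 * ∑ K ∈ T, ‖x K‖ ^ 2 := by rw [← Finset.mul_sum]; ring

/-- Pointwise bound for the remainder equation: the real part of `conj(q)·(−Λ d q − Λ g u + Λ g w m)` against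
norms. [folklore] -/
private theorem two_re_remainder_le (Λ Δ gT gt dJo : ℝ) (q u w m : ℂ) (hΛ : 0 ≤ Λ) (hd : Δ ≤ dJo)
    (hg : |gt| ≤ gT) :
    2 * (conj q * (-(Λ : ℂ) * (dJo : ℂ) * q - (Λ : ℂ) * (gt : ℂ) * u + (Λ : ℂ) * (gt : ℂ) * w * m)).re ≤
      -2 * Λ * Δ * ‖q‖ ^ 2 + 2 * Λ * gT * (‖q‖ * ‖u‖ + ‖m‖ * (‖q‖ * ‖w‖)) := by
  have e : conj q * (-(Λ : ℂ) * (dJo : ℂ) * q - (Λ : ℂ) * (gt : ℂ) * u + (Λ : ℂ) * (gt : ℂ) * w * m) =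
      -(((Λ * dJo : ℝ) : ℂ) * (conj q * q)) - ((Λ * gt : ℝ) : ℂ) * (conj q * u) +
        ((Λ * gt : ℝ) : ℂ) * (conj q * (w * m)) := by
    push_cast; ring
  rw [e, Complex.add_re, Complex.sub_re, Complex.neg_re, Complex.conj_mul', ← Complex.ofReal_pow,
    ← Complex.ofReal_mul, Complex.ofReal_re, Complex.re_ofReal_mul, Complex.re_ofReal_mul]
  have h1 : |(conj q * u).re| ≤ ‖q‖ * ‖u‖ :=
    (Complex.abs_re_le_norm _).trans (by rw [norm_mul, Complex.norm_conj])
  have h2 : |(conj q * (w * m)).re| ≤ ‖q‖ * ‖w‖ * ‖m‖ :=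
    (Complex.abs_re_le_norm _).trans (by rw [norm_mul, norm_mul, Complex.norm_conj, mul_assoc])
  have hgT : 0 ≤ gT := (abs_nonneg _).trans hg
  have h3 : |gt * (conj q * u).re| ≤ gT * (‖q‖ * ‖u‖) := by
    rw [abs_mul]; exact mul_le_mul hg h1 (abs_nonneg _) hgT
  have h4 : |gt * (conj q * (w * m)).re| ≤ gT * (‖q‖ * ‖w‖ * ‖m‖) := by
    rw [abs_mul]; exact mul_le_mul hg h2 (abs_nonneg _) hgT
  have h3' : -(gt * (conj q * u).re) ≤ gT * (‖q‖ * ‖u‖) := (neg_le_abs _).trans h3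
  have h4' : gt * (conj q * (w * m)).re ≤ gT * (‖q‖ * ‖w‖ * ‖m‖) := (le_abs_self _).trans h4
  have h5 : Λ * Δ * ‖q‖ ^ 2 ≤ Λ * dJo * ‖q‖ ^ 2 := by
    have := mul_le_mul_of_nonneg_left hd (mul_nonneg hΛ (sq_nonneg ‖q‖))
    nlinarith [this]
  have h6 := mul_le_mul_of_nonneg_left h3' hΛ
  have h7 := mul_le_mul_of_nonneg_left h4' hΛ
  nlinarith [h5, h6, h7]

/-! ## §1 A one-dimensional invariance principle with interior derivatives only -/

/-- Real induction with a STRICT contact condition: a function continuous on `[a,b]`, differentiable on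
`(a,b)`, starting strictly below a level `C` and with negative derivative at every interior contact point with
the level, stays `≤ C` on `[a,b]`. (The derivative is only needed in the open interval because the start is
strict.) [folklore] -/
private theorem le_of_contact_deriv_neg {f f' : ℝ → ℝ} {a b C : ℝ} (hfc : ContinuousOn f (Icc a b))
    (hf' : ∀ x ∈ Ioo a b, HasDerivAt f (f' x) x) (ha : f a < C)
    (bound : ∀ x ∈ Ioo a b, f x = C → f' x < 0) : ∀ x ∈ Icc a b, f x ≤ C := by
  intro x hx
  rcases eq_or_lt_of_le hx.1 with hxa | hax
  · rw [← hxa]; exact ha.le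
  obtain ⟨δ, hδ, hδf⟩ := Metric.continuousWithinAt_iff.1 (hfc a ⟨le_rfl, hx.1.trans hx.2⟩) (C - f a)
    (by linarith)
  set a' := min (a + δ / 2) x with ha'def
  have ha'a : a < a' := lt_min (by linarith) hax
  have ha'x : a' ≤ x := min_le_right _ _
  have ha'b : a' ≤ b := ha'x.trans hx.2
  have hfa' : f a' ≤ C := by
    have hmem : a' ∈ Icc a b := ⟨ha'a.le, ha'b⟩
    have hdist : dist a' a < δ := by
      rw [Real.dist_eq, abs_of_pos (sub_pos.2 ha'a)]
      have : a' ≤ a + δ / 2 := min_le_left _ _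
      linarith
    have h := hδf hmem hdist
    rw [Real.dist_eq] at h
    have := (abs_lt.1 h).2
    linarith
  have key := image_le_of_deriv_right_lt_deriv_boundary' (f := f) (f' := f') (a := a') (b := b)
    (hfc.mono (Icc_subset_Icc ha'a.le le_rfl))
    (fun y hy => (hf' y ⟨ha'a.trans_le hy.1, hy.2⟩).hasDerivWithinAt)
    (B := fun _ => C) (B' := fun _ => 0) hfa' continuousOn_const
    (fun y _ => hasDerivWithinAt_const _ _ _)
    (fun y hy hyC => by simpa using bound y ⟨ha'a.trans_le hy.1, hy.2⟩ hyC)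
  exact key ⟨ha'x, hx.2⟩

/-- Two-sided mean-value bound with interior derivatives only: `|ψ s − ψ a| ≤ C (s − a)` on `[a,b]`. [folklore] -/
private theorem abs_sub_le_of_deriv_abs_le {ψ ψ' : ℝ → ℝ} {a b C : ℝ} (hψc : ContinuousOn ψ (Icc a b))
    (hψ' : ∀ x ∈ Ioo a b, HasDerivAt ψ (ψ' x) x) (hbound : ∀ x ∈ Ioo a b, |ψ' x| ≤ C) :
    ∀ s ∈ Icc a b, |ψ s - ψ a| ≤ C * (s - a) := by
  intro s hs
  have hdiff : DifferentiableOn ℝ ψ (interior (Icc a b)) := by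
    rw [interior_Icc]; exact fun x hx => (hψ' x hx).differentiableAt.differentiableWithinAt
  have hup : ∀ x ∈ interior (Icc a b), deriv ψ x ≤ C := by
    rw [interior_Icc]; intro x hx; rw [(hψ' x hx).deriv]; exact (le_abs_self _).trans (hbound x hx)
  have hlo : ∀ x ∈ interior (Icc a b), -C ≤ deriv ψ x := by
    rw [interior_Icc]; intro x hx; rw [(hψ' x hx).deriv]; exact (neg_le_neg (hbound x hx)).trans (neg_abs_le _)
  have h1 := (convex_Icc a b).image_sub_le_mul_sub_of_deriv_le hψc hdiff hup a (left_mem_Icc.2 (hs.1.trans hs.2))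
    s hs hs.1
  have h2 := (convex_Icc a b).mul_sub_le_image_sub_of_le_deriv hψc hdiff hlo a (left_mem_Icc.2 (hs.1.trans hs.2))
    s hs hs.1
  rw [abs_le]
  constructor <;> linarith

/-! ## §2 The two exact energy identities -/

section Setting

variable {ι : Type*} [Fintype ι] [DecidableEq ι]

omit [DecidableEq ι] in
/-- **Energy identity.** Along `v' = −Λ(Dv + g S v)` with `S` skew-Hermitian, the total energy obeys
`(Σ_J ‖v_J‖²)' = −2Λ Σ_J d_J ‖v_J‖²`: the exchange term is invisible (cf. [cite: Eastham1989, §1.5 (1.5.6)]: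
only the diagonal part `Λ + dg R` carries growth, and here `Re dg(gS) = 0`). [folklore] -/
theorem hasDerivAt_energy (S : Matrix ι ι ℂ) (d : ι → ℝ) (Λ gs : ℝ) (v : ℝ → ι → ℂ) (s : ℝ)
    (hS : ∀ J K, S K J = -conj (S J K))
    (hv : HasDerivAt v (fun J => -(Λ : ℂ) * ((d J : ℂ) * v s J + (gs : ℂ) * ∑ K, S J K * v s K)) s) :
    HasDerivAt (fun t => ∑ J, ‖v t J‖ ^ 2) (-2 * Λ * ∑ J, d J * ‖v s J‖ ^ 2) s := by
  set F : ι → ℂ := fun J => -(Λ : ℂ) * ((d J : ℂ) * v s J + (gs : ℂ) * ∑ K, S J K * v s K) with hF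
  have hvJ : ∀ J, HasDerivAt (fun t => v t J) (F J) s := fun J => (hasDerivAt_pi.1 hv) J
  have hE' : HasDerivAt (fun t => ∑ J, ‖v t J‖ ^ 2) (∑ J, 2 * (conj (v s J) * F J).re) s := by
    have : ∀ J ∈ (univ : Finset ι), HasDerivAt (fun t => ‖v t J‖ ^ 2) (2 * (conj (v s J) * F J).re) s := by
      intro J _
      have h := (hvJ J).norm_sq
      simp only [Complex.inner, mul_comm (F J)] at h
      exact h
    simpa using HasDerivAt.fun_sum this
  refine hE'.congr_deriv ?_
  -- algebra: `Σ 2 Re(conj v_J F_J) = −2Λ Σ d_J |v_J|² − 2Λ g Re(Σ conj v_J (Sv)_J)` and the last term vanishes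
  have hskew := re_sum_conj_mul_mulVec_eq_zero S hS (v s)
  have hterm : ∀ J, (conj (v s J) * F J).re =
      -Λ * (d J * ‖v s J‖ ^ 2) - Λ * gs * (conj (v s J) * ∑ K, S J K * v s K).re := by
    intro J
    have e : conj (v s J) * F J = -(Λ : ℂ) * (d J : ℂ) * (conj (v s J) * v s J)
        - (Λ : ℂ) * (gs : ℂ) * (conj (v s J) * ∑ K, S J K * v s K) := by
      simp only [hF]; ring
    rw [e, Complex.conj_mul', Complex.sub_re]
    have e1 : (-(Λ : ℂ) * (d J : ℂ) * ((‖v s J‖ : ℂ) ^ 2)).re = -Λ * (d J * ‖v s J‖ ^ 2) := by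
      rw [← Complex.ofReal_pow, ← Complex.ofReal_neg, ← Complex.ofReal_mul, ← Complex.ofReal_mul,
        Complex.ofReal_re]; ring
    have e2 : ((Λ : ℂ) * (gs : ℂ) * (conj (v s J) * ∑ K, S J K * v s K)).re =
        Λ * gs * (conj (v s J) * ∑ K, S J K * v s K).re := by
      rw [← Complex.ofReal_mul, Complex.re_ofReal_mul]
    rw [e1, e2]
  have hX : ∑ J, (conj (v s J) * ∑ K, S J K * v s K).re = 0 := by
    rw [← Complex.re_sum]; exact hskew
  calc ∑ J, 2 * (conj (v s J) * F J).re
      = ∑ J, (2 * (-Λ * (d J * ‖v s J‖ ^ 2)) - 2 * Λ * gs * (conj (v s J) * ∑ K, S J K * v s K).re) := by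
        refine Finset.sum_congr rfl fun J _ => ?_
        rw [hterm J]; ring
    _ = -2 * Λ * ∑ J, d J * ‖v s J‖ ^ 2 - 2 * Λ * gs * ∑ J, (conj (v s J) * ∑ K, S J K * v s K).re := by
        rw [Finset.sum_sub_distrib, Finset.mul_sum, Finset.mul_sum]
        congr 1
        refine Finset.sum_congr rfl fun J _ => ?_
        ring
    _ = -2 * Λ * ∑ J, d J * ‖v s J‖ ^ 2 := by rw [hX, mul_zero, sub_zero]

/-- **Slow-mode identity.** Along the field, `(‖v_o‖²)' = −2Λ(d_o‖v_o‖² + g·Re(conj(v_o) Σ_{K≠o} S_{oK} v_K))`;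
the diagonal entry `S_{oo} ∈ iℝ` does not contribute (cf. [cite: Eastham1989, §1.5 (1.5.5)–(1.5.6)], the
exponent `λ_k + r_kk`). [folklore] -/
theorem hasDerivAt_slowEnergy (S : Matrix ι ι ℂ) (d : ι → ℝ) (o : ι) (Λ gs : ℝ) (v : ℝ → ι → ℂ) (s : ℝ)
    (hS : ∀ J K, S K J = -conj (S J K))
    (hv : HasDerivAt v (fun J => -(Λ : ℂ) * ((d J : ℂ) * v s J + (gs : ℂ) * ∑ K, S J K * v s K)) s) :
    HasDerivAt (fun t => ‖v t o‖ ^ 2)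
      (-2 * Λ * (d o * ‖v s o‖ ^ 2 + gs * (conj (v s o) * ∑ K ∈ univ.erase o, S o K * v s K).re)) s := by
  set F : ι → ℂ := fun J => -(Λ : ℂ) * ((d J : ℂ) * v s J + (gs : ℂ) * ∑ K, S J K * v s K) with hF
  have hvo : HasDerivAt (fun t => v t o) (F o) s := (hasDerivAt_pi.1 hv) o
  have hA' : HasDerivAt (fun t => ‖v t o‖ ^ 2) (2 * (conj (v s o) * F o).re) s := by
    have h := hvo.norm_sq
    simp only [Complex.inner, mul_comm (F o)] at h
    exact h
  refine hA'.congr_deriv ?_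
  have e : conj (v s o) * F o = -(Λ : ℂ) * (d o : ℂ) * (conj (v s o) * v s o)
      - (Λ : ℂ) * (gs : ℂ) * (conj (v s o) * ∑ K, S o K * v s K) := by
    simp only [hF]; ring
  rw [e, Complex.conj_mul', Complex.sub_re]
  have e1 : (-(Λ : ℂ) * (d o : ℂ) * ((‖v s o‖ : ℂ) ^ 2)).re = -Λ * (d o * ‖v s o‖ ^ 2) := by
    rw [← Complex.ofReal_pow, ← Complex.ofReal_neg, ← Complex.ofReal_mul, ← Complex.ofReal_mul,
      Complex.ofReal_re]; ring
  have e2 : ((Λ : ℂ) * (gs : ℂ) * (conj (v s o) * ∑ K, S o K * v s K)).re =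
      Λ * gs * (conj (v s o) * ∑ K, S o K * v s K).re := by
    rw [← Complex.ofReal_mul, Complex.re_ofReal_mul]
  rw [e1, e2, re_conj_mul_row_eq S hS o (v s)]
  ring


/-! ## §3 Slaving: the invariant slow cone -/

/-- **Slaving of the fast components (invariant slow cone).** In the setting of the module docstring, with
gap `d J ≥ d o + Δ` off the slow index and `γ² = Σ_{K≠o} ‖S o K‖²`: if `0 < R` and
`g_T γ (1 + R²) < Δ R`, then every trajectory with `Σ_{J≠o} ‖v_J(a)‖² < R² ‖v_o(a)‖²` satisfies
`Σ_{J≠o} ‖v_J(s)‖² ≤ R² ‖v_o(s)‖²` and `v_o(s) ≠ 0` for all `s ∈ [a, b]`. This is the bounded solution of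
Chang's Riccati equation, column by column: the ratios `v_J/v_o` stay in the ball of radius `R = O(g_T γ/Δ)`.
[cite: KokotovicBensoussanBlankenship1987, Kokotović §2 eq. (2.29), Thm 2.3] [cite: Chang1972] -/
theorem slowCone_invariant (S : Matrix ι ι ℂ) (d : ι → ℝ) (o : ι) (Λ gT Δ γ R a b : ℝ) (g : ℝ → ℝ)
    (v : ℝ → ι → ℂ) (hS : ∀ J K, S K J = -conj (S J K))
    (hγ : γ ^ 2 = ∑ K ∈ univ.erase o, ‖S o K‖ ^ 2) (hγ0 : 0 ≤ γ)
    (hΔ : ∀ J, J ≠ o → d o + Δ ≤ d J) (hΛ : 0 < Λ)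
    (hg : ∀ s ∈ Ioo a b, |g s| ≤ gT) (hR : 0 < R) (htrap : gT * γ * (1 + R ^ 2) < Δ * R)
    (hcont : ContinuousOn v (Icc a b))
    (hderiv : ∀ s ∈ Ioo a b, HasDerivAt v
        (fun J => -(Λ : ℂ) * ((d J : ℂ) * v s J + (g s : ℂ) * ∑ K, S J K * v s K)) s)
    (hinit : ∑ J ∈ univ.erase o, ‖v a J‖ ^ 2 < R ^ 2 * ‖v a o‖ ^ 2) :
    ∀ s ∈ Icc a b, ∑ J ∈ univ.erase o, ‖v s J‖ ^ 2 ≤ R ^ 2 * ‖v s o‖ ^ 2 ∧ 0 < ‖v s o‖ := by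
  -- notation: total energy `E`, slow energy `A`, fast energy `Z`
  set E : ℝ → ℝ := fun t => ∑ J, ‖v t J‖ ^ 2 with hE
  set A : ℝ → ℝ := fun t => ‖v t o‖ ^ 2 with hA
  set Z : ℝ → ℝ := fun t => ∑ J ∈ univ.erase o, ‖v t J‖ ^ 2 with hZ
  have hEZ : ∀ t, E t = A t + Z t := fun t => by
    simp only [hE, hA, hZ]; rw [← Finset.add_sum_erase _ _ (Finset.mem_univ o)]
  have hZnn : ∀ t, 0 ≤ Z t := fun t => Finset.sum_nonneg fun J _ => by positivity
  have hvJ : ∀ J, ContinuousOn (fun t => v t J) (Icc a b) := fun J => continuousOn_pi.1 hcont J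
  have hEc : ContinuousOn E (Icc a b) := continuousOn_finsetSum _ fun J _ => ((hvJ J).norm).pow 2
  have hAc : ContinuousOn A (Icc a b) := ((hvJ o).norm).pow 2
  have hAa : 0 < A a := by
    have h1 : R ^ 2 * 0 < R ^ 2 * ‖v a o‖ ^ 2 := by rw [mul_zero]; exact lt_of_le_of_lt (hZnn a) hinit
    exact lt_of_mul_lt_mul_left h1 (sq_nonneg R)
  -- conclusion from `Z ≤ R² A` and `E > 0`
  have hfinish : ∀ s, Z s ≤ R ^ 2 * A s → 0 < E s → Z s ≤ R ^ 2 * A s ∧ 0 < ‖v s o‖ := by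
    intro s h1 h2
    refine ⟨h1, ?_⟩
    have hApos : 0 < A s := by
      rw [hEZ] at h2
      by_contra hcon
      have hA0 : A s = 0 := le_antisymm (not_lt.1 hcon) (by positivity)
      rw [hA0, mul_zero] at h1
      linarith [hZnn s]
    have hne : ‖v s o‖ ≠ 0 := fun h0 => by simp [hA, h0] at hApos
    exact (norm_nonneg _).lt_of_ne hne.symm
  intro s hs
  rcases le_or_gt b a with hba | hab
  · -- degenerate interval
    have hsa : s = a := le_antisymm (le_trans hs.2 hba) hs.1
    subst hsa
    refine hfinish s hinit.le ?_
    rw [hEZ]; linarith [hZnn s]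
  -- energy derivative in the interior
  have hE' : ∀ t ∈ Ioo a b, HasDerivAt E (-2 * Λ * ∑ J, d J * ‖v t J‖ ^ 2) t := fun t ht =>
    hasDerivAt_energy S d Λ (g t) v t hS (hderiv t ht)
  have hA' : ∀ t ∈ Ioo a b, HasDerivAt A
      (-2 * Λ * (d o * ‖v t o‖ ^ 2 + g t * (conj (v t o) * ∑ K ∈ univ.erase o, S o K * v t K).re)) t :=
    fun t ht => hasDerivAt_slowEnergy S d o Λ (g t) v t hS (hderiv t ht)
  -- Step 1: the energy never vanishes (backward Grönwall with the crude rate bound `dm = Σ |d J|`)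
  set dm : ℝ := ∑ J, |d J| with hdm
  have hdJ : ∀ J, d J ≤ dm := fun J =>
    (le_abs_self _).trans (Finset.single_le_sum (fun K _ => abs_nonneg (d K)) (Finset.mem_univ J))
  have hmono : MonotoneOn (fun t => Real.exp (2 * Λ * dm * (t - a)) * E t) (Icc a b) := by
    have hexp : ∀ t, HasDerivAt (fun t => Real.exp (2 * Λ * dm * (t - a)))
        (Real.exp (2 * Λ * dm * (t - a)) * (2 * Λ * dm)) t := by
      intro t
      have := (((hasDerivAt_id t).sub_const a).const_mul (2 * Λ * dm)).exp
      simpa using this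
    refine monotoneOn_of_deriv_nonneg (convex_Icc a b) ?_ ?_ ?_
    · exact (Real.continuous_exp.comp (continuous_const.mul (continuous_id.sub continuous_const))
        ).continuousOn.mul hEc
    · rw [interior_Icc]; intro t ht
      exact ((hexp t).mul (hE' t ht)).differentiableAt.differentiableWithinAt
    · rw [interior_Icc]; intro t ht
      have hmul : HasDerivAt (fun t => Real.exp (2 * Λ * dm * (t - a)) * E t)
          (Real.exp (2 * Λ * dm * (t - a)) * (2 * Λ * dm) * E t +
            Real.exp (2 * Λ * dm * (t - a)) * (-2 * Λ * ∑ J, d J * ‖v t J‖ ^ 2)) t :=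
        (hexp t).mul (hE' t ht)
      rw [hmul.deriv]
      have hsum : ∑ J, d J * ‖v t J‖ ^ 2 ≤ dm * E t := by
        simp only [hE]; rw [Finset.mul_sum]
        exact Finset.sum_le_sum fun J _ => mul_le_mul_of_nonneg_right (hdJ J) (by positivity)
      have hpos : 0 < Real.exp (2 * Λ * dm * (t - a)) := Real.exp_pos _
      have key : Real.exp (2 * Λ * dm * (t - a)) * (2 * Λ * dm) * E t +
          Real.exp (2 * Λ * dm * (t - a)) * (-2 * Λ * ∑ J, d J * ‖v t J‖ ^ 2) =
          2 * (Real.exp (2 * Λ * dm * (t - a)) * Λ * (dm * E t - ∑ J, d J * ‖v t J‖ ^ 2)) := by ring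
      rw [key]
      exact mul_nonneg (by norm_num) (mul_nonneg (mul_nonneg hpos.le hΛ.le) (sub_nonneg.2 hsum))
  have hEpos : ∀ t ∈ Icc a b, 0 < E t := by
    intro t ht
    have h := hmono (left_mem_Icc.2 hab.le) ht ht.1
    simp only [sub_self, mul_zero, Real.exp_zero, one_mul] at h
    have hEa : 0 < E a := by rw [hEZ]; linarith [hZnn a]
    by_contra hcon
    rw [not_lt] at hcon
    nlinarith [Real.exp_pos (2 * Λ * dm * (t - a)), hcon, h, hEa]
  -- Step 2: the cone defect `f = Z − R² A = E − (1 + R²) A` and its contact derivative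
  set f : ℝ → ℝ := fun t => E t - (1 + R ^ 2) * A t with hf
  set f' : ℝ → ℝ := fun t => -2 * Λ * ∑ J, d J * ‖v t J‖ ^ 2 -
      (1 + R ^ 2) * (-2 * Λ * (d o * ‖v t o‖ ^ 2 +
        g t * (conj (v t o) * ∑ K ∈ univ.erase o, S o K * v t K).re)) with hf'
  have hfZ : ∀ t, f t = Z t - R ^ 2 * A t := fun t => by simp only [hf]; rw [hEZ]; ring
  have hfc : ContinuousOn f (Icc a b) := hEc.sub (hAc.const_smul (1 + R ^ 2) |>.congr
    (fun t _ => by simp [smul_eq_mul]))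
  have hfd : ∀ t ∈ Ioo a b, HasDerivAt f (f' t) t := fun t ht => (hE' t ht).sub ((hA' t ht).const_mul _)
  have hfa : f a < 0 := by rw [hfZ]; linarith
  have hcontact : ∀ t ∈ Ioo a b, f t = 0 → f' t < 0 := by
    intro t ht hft
    have hZt : Z t = R ^ 2 * A t := by rw [hfZ] at hft; linarith
    have hAt : 0 < A t := by
      have := hEpos t (Ioo_subset_Icc_self ht)
      rw [hEZ, hZt] at this
      nlinarith [sq_nonneg R]
    -- the slow row, Cauchy–Schwarz: `|X| ≤ ‖v_o‖ γ √Z = γ R A`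
    set X : ℝ := (conj (v t o) * ∑ K ∈ univ.erase o, S o K * v t K).re with hX
    have hXle : |X| ≤ γ * R * A t := by
      have h1 : |X| ≤ ‖conj (v t o) * ∑ K ∈ univ.erase o, S o K * v t K‖ := Complex.abs_re_le_norm _
      have h2 : ‖conj (v t o) * ∑ K ∈ univ.erase o, S o K * v t K‖ =
          ‖v t o‖ * ‖∑ K ∈ univ.erase o, S o K * v t K‖ := by
        rw [norm_mul, Complex.norm_conj]
      have h3 : ‖∑ K ∈ univ.erase o, S o K * v t K‖ ≤ γ * Real.sqrt (Z t) := by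
        have := norm_sum_mul_le_sqrt (univ.erase o) (fun K => S o K) (fun K => v t K)
        rwa [← hγ, Real.sqrt_sq hγ0] at this
      have h4 : Real.sqrt (Z t) = R * ‖v t o‖ := by
        rw [hZt, hA, show R ^ 2 * ‖v t o‖ ^ 2 = (R * ‖v t o‖) ^ 2 by ring,
          Real.sqrt_sq (mul_nonneg hR.le (norm_nonneg _))]
      calc |X| ≤ ‖v t o‖ * ‖∑ K ∈ univ.erase o, S o K * v t K‖ := h1.trans h2.le
        _ ≤ ‖v t o‖ * (γ * (R * ‖v t o‖)) := by
            rw [← h4]; exact mul_le_mul_of_nonneg_left h3 (norm_nonneg _)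
        _ = γ * R * A t := by simp only [hA]; ring
    -- the diagonal part: `Σ d_J |v_J|² ≥ d_o A + (d_o + Δ) Z`
    have hsumd : d o * A t + (d o + Δ) * Z t ≤ ∑ J, d J * ‖v t J‖ ^ 2 := by
      rw [← Finset.add_sum_erase _ _ (Finset.mem_univ o)]
      simp only [hA, hZ]
      rw [Finset.mul_sum]
      refine add_le_add le_rfl (Finset.sum_le_sum fun J hJ => ?_)
      exact mul_le_mul_of_nonneg_right (hΔ J (Finset.ne_of_mem_erase hJ)) (by positivity)
    have hgt : |g t| ≤ gT := hg t ht
    have hB2 : g t * X ≤ gT * (γ * R * A t) := by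
      calc g t * X ≤ |g t * X| := le_abs_self _
        _ = |g t| * |X| := abs_mul _ _
        _ ≤ gT * (γ * R * A t) := mul_le_mul hgt hXle (abs_nonneg _) ((abs_nonneg _).trans hgt)
    have hB1 := mul_le_mul_of_nonneg_left hsumd (by positivity : (0 : ℝ) ≤ 2 * Λ)
    have hB2' := mul_le_mul_of_nonneg_left hB2 (by positivity : (0 : ℝ) ≤ 2 * Λ * (1 + R ^ 2))
    have hneg : 2 * Λ * A t * R * (gT * γ * (1 + R ^ 2) - Δ * R) < 0 :=
      mul_neg_of_pos_of_neg (by positivity) (by linarith)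
    have hf't : f' t = -2 * Λ * ∑ J, d J * ‖v t J‖ ^ 2 + 2 * Λ * (1 + R ^ 2) * (d o * A t) +
        2 * Λ * (1 + R ^ 2) * (g t * X) := by simp only [hf', hX, hA]; ring
    rw [hf't]
    rw [hZt] at hB1
    nlinarith [hB1, hB2', hneg]
  have hfle := le_of_contact_deriv_neg hfc hfd hfa hcontact
  -- Step 3: conclude
  have h1 : Z s ≤ R ^ 2 * A s := by have := hfle s hs; rw [hfZ] at this; linarith
  exact hfinish s h1 (hEpos s hs)

/-- The standard choice of radius: `R = 2 g_T γ / Δ` is admissible in `slowCone_invariant` as soon as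
`0 < g_T γ` and `2 g_T γ < Δ`. [cite: KokotovicBensoussanBlankenship1987, Kokotović §2 (2.40)] -/
theorem slowCone_radius_two_mul (gT γ Δ : ℝ) (hpos : 0 < gT * γ) (hsmall : 2 * (gT * γ) < Δ) :
    0 < 2 * (gT * γ) / Δ ∧ gT * γ * (1 + (2 * (gT * γ) / Δ) ^ 2) < Δ * (2 * (gT * γ) / Δ) := by
  have hΔ : 0 < Δ := lt_trans (by linarith) hsmall
  set R := 2 * (gT * γ) / Δ with hR
  have hR0 : 0 < R := div_pos (by linarith) hΔ
  have hR1 : R < 1 := by rw [hR, div_lt_one hΔ]; exact hsmall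
  have hΔR : Δ * R = 2 * (gT * γ) := by rw [hR]; field_simp
  refine ⟨hR0, ?_⟩
  rw [hΔR]
  have : R ^ 2 < 1 := by nlinarith
  nlinarith

/-! ## §4 The exact slow law -/

/-- Along the field, at a point where `v_o ≠ 0`, with the ratios `w_K = v_K / v_o`:
`(log ‖v_o‖²)' = −2Λ (d_o + g·Re Σ_{K≠o} S_{oK} w_K)` — the EXACT instantaneous decay rate of the slow mode is
its bare rate plus the coupling row evaluated on the ratio vector (the one-column form of Hartman–Wintner's
`λ_k + r_kk`). [cite: Eastham1989, §1.5 Thm 1.5.1 (1.5.5)] -/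
theorem hasDerivAt_log_slowEnergy (S : Matrix ι ι ℂ) (d : ι → ℝ) (o : ι) (Λ gs : ℝ) (v : ℝ → ι → ℂ)
    (s : ℝ) (hS : ∀ J K, S K J = -conj (S J K))
    (hv : HasDerivAt v (fun J => -(Λ : ℂ) * ((d J : ℂ) * v s J + (gs : ℂ) * ∑ K, S J K * v s K)) s)
    (hvo : v s o ≠ 0) :
    HasDerivAt (fun t => Real.log (‖v t o‖ ^ 2))
      (-2 * Λ * (d o + gs * (∑ K ∈ univ.erase o, S o K * (v s K / v s o)).re)) s := by
  have hA := hasDerivAt_slowEnergy S d o Λ gs v s hS hv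
  have hA0 : ‖v s o‖ ^ 2 ≠ 0 := pow_ne_zero 2 (norm_ne_zero_iff.2 hvo)
  have hlog := hA.log hA0
  refine hlog.congr_deriv ?_
  have hrow : conj (v s o) * ∑ K ∈ univ.erase o, S o K * v s K =
      ((‖v s o‖ ^ 2 : ℝ) : ℂ) * ∑ K ∈ univ.erase o, S o K * (v s K / v s o) := by
    rw [Complex.ofReal_pow, ← Complex.conj_mul', Finset.mul_sum, Finset.mul_sum]
    refine Finset.sum_congr rfl fun K _ => ?_
    rw [mul_assoc, mul_left_comm (v s o), mul_div_cancel₀ _ hvo]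
  rw [hrow, Complex.re_ofReal_mul]
  field_simp

/-- **Crude two-sided slow law** inside the invariant cone: under the hypotheses of `slowCone_invariant`,
`|log ‖v_o(s)‖² − log ‖v_o(a)‖² + 2Λ d_o (s − a)| ≤ 2Λ g_T γ R (s − a)` on `[a,b]` — the slow mode decays
at its bare rate up to `O(g_T γ R) = O(g_T² γ²/Δ)`. [cite: Eastham1989, §1.5 Thm 1.5.1] -/
theorem abs_log_slowEnergy_sub_le (S : Matrix ι ι ℂ) (d : ι → ℝ) (o : ι) (Λ gT γ R a b : ℝ)
    (g : ℝ → ℝ) (v : ℝ → ι → ℂ) (hS : ∀ J K, S K J = -conj (S J K))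
    (hγ : γ ^ 2 = ∑ K ∈ univ.erase o, ‖S o K‖ ^ 2) (hγ0 : 0 ≤ γ) (hΛ : 0 < Λ)
    (hg : ∀ s ∈ Ioo a b, |g s| ≤ gT) (hR : 0 ≤ R)
    (hcont : ContinuousOn v (Icc a b))
    (hderiv : ∀ s ∈ Ioo a b, HasDerivAt v
        (fun J => -(Λ : ℂ) * ((d J : ℂ) * v s J + (g s : ℂ) * ∑ K, S J K * v s K)) s)
    (hcone : ∀ s ∈ Icc a b, ∑ J ∈ univ.erase o, ‖v s J‖ ^ 2 ≤ R ^ 2 * ‖v s o‖ ^ 2 ∧ 0 < ‖v s o‖) :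
    ∀ s ∈ Icc a b, |Real.log (‖v s o‖ ^ 2) - Real.log (‖v a o‖ ^ 2) + 2 * Λ * d o * (s - a)| ≤
      2 * Λ * gT * γ * R * (s - a) := by
  intro s hs
  set ψ : ℝ → ℝ := fun t => Real.log (‖v t o‖ ^ 2) + 2 * Λ * d o * (t - a) with hψ
  set ψ' : ℝ → ℝ := fun t => -2 * Λ * (d o + g t * (∑ K ∈ univ.erase o, S o K * (v t K / v t o)).re)
    + 2 * Λ * d o with hψ'
  have hvJ : ∀ J, ContinuousOn (fun t => v t J) (Icc a b) := fun J => continuousOn_pi.1 hcont J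
  have hψc : ContinuousOn ψ (Icc a b) := by
    refine ContinuousOn.add (ContinuousOn.log (((hvJ o).norm).pow 2) fun t ht => ?_) (by fun_prop)
    exact pow_ne_zero 2 (ne_of_gt (hcone t ht).2)
  have hψd : ∀ t ∈ Ioo a b, HasDerivAt ψ (ψ' t) t := by
    intro t ht
    have hvo : v t o ≠ 0 := norm_pos_iff.1 (hcone t (Ioo_subset_Icc_self ht)).2
    have h1 := hasDerivAt_log_slowEnergy S d o Λ (g t) v t hS (hderiv t ht) hvo
    have h2 : HasDerivAt (fun t => 2 * Λ * d o * (t - a)) (2 * Λ * d o) t := by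
      simpa using ((hasDerivAt_id t).sub_const a).const_mul (2 * Λ * d o)
    exact h1.add h2
  have hbound : ∀ t ∈ Ioo a b, |ψ' t| ≤ 2 * Λ * gT * γ * R := by
    intro t ht
    obtain ⟨hc1, hc2⟩ := hcone t (Ioo_subset_Icc_self ht)
    have hvo : v t o ≠ 0 := norm_pos_iff.1 hc2
    -- `Σ_{K≠o} ‖w_K‖² ≤ R²`
    have hw : ∑ K ∈ univ.erase o, ‖v t K / v t o‖ ^ 2 ≤ R ^ 2 := by
      have : ∑ K ∈ univ.erase o, ‖v t K / v t o‖ ^ 2 = (∑ K ∈ univ.erase o, ‖v t K‖ ^ 2) / ‖v t o‖ ^ 2 := by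
        rw [Finset.sum_div]
        refine Finset.sum_congr rfl fun K _ => ?_
        rw [norm_div, div_pow]
      rw [this, div_le_iff₀ (by positivity)]
      exact hc1
    have hm : ‖∑ K ∈ univ.erase o, S o K * (v t K / v t o)‖ ≤ γ * R := by
      have := norm_sum_mul_le_sqrt (univ.erase o) (fun K => S o K) (fun K => v t K / v t o)
      rw [← hγ, Real.sqrt_sq hγ0] at this
      refine this.trans (mul_le_mul_of_nonneg_left ?_ hγ0)
      calc Real.sqrt (∑ K ∈ univ.erase o, ‖v t K / v t o‖ ^ 2) ≤ Real.sqrt (R ^ 2) := Real.sqrt_le_sqrt hw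
        _ = R := Real.sqrt_sq hR
    have hre : |(∑ K ∈ univ.erase o, S o K * (v t K / v t o)).re| ≤ γ * R :=
      (Complex.abs_re_le_norm _).trans hm
    have hψ't : ψ' t = -2 * Λ * (g t * (∑ K ∈ univ.erase o, S o K * (v t K / v t o)).re) := by
      simp only [hψ']; ring
    have hprod : |g t * (∑ K ∈ univ.erase o, S o K * (v t K / v t o)).re| ≤ gT * (γ * R) := by
      rw [abs_mul]
      exact mul_le_mul (hg t ht) hre (abs_nonneg _) ((abs_nonneg _).trans (hg t ht))
    rw [hψ't, abs_mul, show |(-2 : ℝ) * Λ| = 2 * Λ by rw [abs_mul, abs_neg, abs_two, abs_of_pos hΛ]]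
    nlinarith [hprod, hΛ]
  have key := abs_sub_le_of_deriv_abs_le hψc hψd hbound s hs
  have : ψ s - ψ a = Real.log (‖v s o‖ ^ 2) - Real.log (‖v a o‖ ^ 2) + 2 * Λ * d o * (s - a) := by
    simp only [hψ]; ring
  rw [this] at key
  linarith [key, le_refl (2 * Λ * gT * γ * R * (s - a))]


/-! ## §5 The projective Riccati equation and its first-order (Hartman–Wintner) expansion -/

omit [DecidableEq ι] in
/-- **The Riccati equation of the ratios.** At a point where `v_o ≠ 0`, each ratio `w_J = v_J / v_o` satisfies
`w_J' = −Λ((d_J − d_o) w_J + g (S w)_J − g w_J (S w)_o)` (note `w_o ≡ 1`). This is the column form of Chang's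
Riccati equation `εL̇ = DL − εLA + εLBL − C`. [cite: KokotovicBensoussanBlankenship1987, Kokotović §2 eq. (2.29)]
[cite: Chang1972] -/
theorem hasDerivAt_ratio (S : Matrix ι ι ℂ) (d : ι → ℝ) (o : ι) (Λ gs : ℝ) (v : ℝ → ι → ℂ) (s : ℝ)
    (hv : HasDerivAt v (fun J => -(Λ : ℂ) * ((d J : ℂ) * v s J + (gs : ℂ) * ∑ K, S J K * v s K)) s)
    (hvo : v s o ≠ 0) (J : ι) :
    HasDerivAt (fun t => v t J / v t o)
      (-(Λ : ℂ) * (((d J - d o : ℝ) : ℂ) * (v s J / v s o) + (gs : ℂ) * ∑ K, S J K * (v s K / v s o)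
        - (gs : ℂ) * (v s J / v s o) * ∑ K, S o K * (v s K / v s o))) s := by
  set F : ι → ℂ := fun J => -(Λ : ℂ) * ((d J : ℂ) * v s J + (gs : ℂ) * ∑ K, S J K * v s K) with hF
  have hvJ : ∀ J, HasDerivAt (fun t => v t J) (F J) s := fun J => (hasDerivAt_pi.1 hv) J
  have h := (hvJ J).fun_div (hvJ o) hvo
  refine h.congr_deriv ?_
  have hs1 : ∑ K, S J K * (v s K / v s o) = (∑ K, S J K * v s K) / v s o := by
    rw [Finset.sum_div]; exact Finset.sum_congr rfl fun K _ => (mul_div_assoc _ _ _).symm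
  have hs2 : ∑ K, S o K * (v s K / v s o) = (∑ K, S o K * v s K) / v s o := by
    rw [Finset.sum_div]; exact Finset.sum_congr rfl fun K _ => (mul_div_assoc _ _ _).symm
  rw [hs1, hs2]
  simp only [hF]
  field_simp
  push_cast
  ring

omit [Fintype ι] [DecidableEq ι] in
/-- A decoupled mode driven through the slow column: if `j_K` is a real Duhamel response of the coupling,
`j_K' = g − Λ(d_K − d_o) j_K` (the shape of `LatticeShear.hasDerivAt_duhamel` after the time change), then
`ρ_K := −Λ S_{Ko} j_K` solves the first-order (Hartman–Wintner) equation `ρ_K' = −Λ((d_K − d_o)ρ_K + g S_{Ko})`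
used in `ratio_remainder_le`. [cite: Eastham1989, §1.5 (1.5.9)] -/
theorem hasDerivAt_duhamelMode (S : Matrix ι ι ℂ) (d : ι → ℝ) (o K : ι) (Λ gs : ℝ) (j : ℝ → ℝ) (j' : ℝ)
    (s : ℝ) (hj : HasDerivAt j j' s) (hj' : j' = gs - Λ * (d K - d o) * j s) :
    HasDerivAt (fun t => -(Λ : ℂ) * S K o * (j t : ℂ))
      (-(Λ : ℂ) * (((d K - d o : ℝ) : ℂ) * (-(Λ : ℂ) * S K o * (j s : ℂ)) + (gs : ℂ) * S K o)) s := by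
  have h1 : HasDerivAt (fun t => (j t : ℂ)) ((j' : ℝ) : ℂ) s := hj.ofReal_comp
  have h2 := h1.const_mul (-(Λ : ℂ) * S K o)
  refine h2.congr_deriv ?_
  rw [hj']
  push_cast
  ring

/-- The exponent for Duhamel responses: if `ρ_K = −Λ S_{Ko} j_K` with `j_K` real (`K ≠ o`), then by skewness
`Re Σ_{K≠o} S_{oK} ρ_K = Λ Σ_{K≠o} ‖S_{oK}‖² j_K` — a positive combination of the double integrals `∫ g·J`
of `Literature.Analysis.FluidPDE.QuasiStaticSlotWeight`. [cite: Eastham1989, §1.6 (second-order diagonal terms)] -/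
theorem re_sum_mul_duhamelMode (S : Matrix ι ι ℂ) (o : ι) (Λ : ℝ) (ρ : ι → ℂ) (j : ι → ℝ)
    (hS : ∀ J K, S K J = -conj (S J K)) (hρ : ∀ K, K ≠ o → ρ K = -(Λ : ℂ) * S K o * (j K : ℂ)) :
    (∑ K ∈ univ.erase o, S o K * ρ K).re = Λ * ∑ K ∈ univ.erase o, ‖S o K‖ ^ 2 * j K := by
  rw [Complex.re_sum, Finset.mul_sum]
  refine Finset.sum_congr rfl fun K hK => ?_
  rw [hρ K (Finset.ne_of_mem_erase hK), hS o K]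
  have : S o K * (-(Λ : ℂ) * -conj (S o K) * (j K : ℂ)) = ((Λ * j K : ℝ) : ℂ) * (S o K * conj (S o K)) := by
    push_cast; ring
  rw [this, Complex.mul_conj', ← Complex.ofReal_pow, ← Complex.ofReal_mul, Complex.ofReal_re]
  ring

/-- **First-order expansion of the ratios with an explicit remainder (uniform in `ι`).** Inside the invariant
cone of `slowCone_invariant` (taken as hypothesis `hcone`), compare the ratios `w_J = v_J/v_o` with ANY solution
family `ρ_J` (`J ≠ o`) of the decoupled linear equations `ρ_J' = −Λ((d_J − d_o)ρ_J + g S_{Jo})` with the same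
data at `a`. If the fast–fast block of `S` has `ℓ²`-operator norm `≤ σ` on vectors supported off `o`, then
`Σ_{J≠o} ‖w_J(s) − ρ_J(s)‖² ≤ Q²` on `[a,b]`, `Q = g_T R (σ + ‖S_{oo}‖ + γR)/Δ`: the remainder of the
Hartman–Wintner transformation is `O(g_T² γ σ/Δ²)` when `R = O(g_T γ/Δ)`. (Skewness of `S` is not used here.)
[cite: Eastham1989, §1.5 Thm 1.5.1, (1.5.8)–(1.5.10)] [cite: KokotovicBensoussanBlankenship1987, Kokotović §2 Thm 2.3 (2.40)] -/
theorem ratio_remainder_le (S : Matrix ι ι ℂ) (d : ι → ℝ) (o : ι) (Λ gT Δ γ R σ a b : ℝ) (g : ℝ → ℝ)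
    (v ρ : ℝ → ι → ℂ)
    (hγ : γ ^ 2 = ∑ K ∈ univ.erase o, ‖S o K‖ ^ 2) (hγ0 : 0 ≤ γ)
    (hΔ : ∀ J, J ≠ o → d o + Δ ≤ d J) (hΔ0 : 0 < Δ) (hΛ : 0 < Λ)
    (hg : ∀ s ∈ Ioo a b, |g s| ≤ gT) (hgT : 0 ≤ gT) (hR : 0 ≤ R) (hσ0 : 0 ≤ σ)
    (hσ : ∀ x : ι → ℂ, ∑ J ∈ univ.erase o, ‖∑ K ∈ univ.erase o, S J K * x K‖ ^ 2 ≤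
      σ ^ 2 * ∑ K ∈ univ.erase o, ‖x K‖ ^ 2)
    (hcont : ContinuousOn v (Icc a b))
    (hderiv : ∀ s ∈ Ioo a b, HasDerivAt v
        (fun J => -(Λ : ℂ) * ((d J : ℂ) * v s J + (g s : ℂ) * ∑ K, S J K * v s K)) s)
    (hcone : ∀ s ∈ Icc a b, ∑ J ∈ univ.erase o, ‖v s J‖ ^ 2 ≤ R ^ 2 * ‖v s o‖ ^ 2 ∧ 0 < ‖v s o‖)
    (hρc : ∀ J, J ≠ o → ContinuousOn (fun t => ρ t J) (Icc a b))
    (hρd : ∀ s ∈ Ioo a b, ∀ J, J ≠ o → HasDerivAt (fun t => ρ t J)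
        (-(Λ : ℂ) * (((d J - d o : ℝ) : ℂ) * ρ s J + (g s : ℂ) * S J o)) s)
    (hρa : ∀ J, J ≠ o → ρ a J = v a J / v a o) :
    ∀ s ∈ Icc a b, ∑ J ∈ univ.erase o, ‖v s J / v s o - ρ s J‖ ^ 2 ≤
      (gT * R * (σ + ‖S o o‖ + γ * R) / Δ) ^ 2 := by
  set T := (univ : Finset ι).erase o with hT
  set Q : ℝ := gT * R * (σ + ‖S o o‖ + γ * R) / Δ with hQ
  have hQ0 : 0 ≤ Q := by positivity
  have hΔQ : Δ * Q = gT * R * (σ + ‖S o o‖ + γ * R) := by rw [hQ]; field_simp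
  set Y : ℝ → ℝ := fun t => ∑ J ∈ T, ‖v t J / v t o - ρ t J‖ ^ 2 with hY
  have hvJ : ∀ J, ContinuousOn (fun t => v t J) (Icc a b) := fun J => continuousOn_pi.1 hcont J
  have hvo0 : ∀ t ∈ Icc a b, v t o ≠ 0 := fun t ht => norm_pos_iff.1 (hcone t ht).2
  have hwc : ∀ J, ContinuousOn (fun t => v t J / v t o) (Icc a b) := fun J => (hvJ J).div (hvJ o) hvo0
  have hYc : ContinuousOn Y (Icc a b) := continuousOn_finsetSum _ fun J hJ =>
    (((hwc J).sub (hρc J (Finset.ne_of_mem_erase hJ))).norm).pow 2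
  have hYa : Y a = 0 := by
    simp only [hY]
    exact Finset.sum_eq_zero fun J hJ => by rw [hρa J (Finset.ne_of_mem_erase hJ), sub_self]; simp
  have hYnn : ∀ t, 0 ≤ Y t := fun t => Finset.sum_nonneg fun J _ => by positivity
  intro s hs
  show Y s ≤ Q ^ 2
  rcases le_or_gt b a with hba | hab
  · have hsa : s = a := le_antisymm (le_trans hs.2 hba) hs.1
    subst hsa; rw [hYa]; positivity
  -- the differential inequality `Y' ≤ −2ΛΔ Y + 2ΛΔ Q √Y` in the interior
  have hYd : ∀ t ∈ Ioo a b, ∃ D, HasDerivAt Y D t ∧ D ≤ -2 * Λ * Δ * Y t + 2 * Λ * Δ * Q * Real.sqrt (Y t) := by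
    intro t ht
    obtain ⟨hc1, hc2⟩ := hcone t (Ioo_subset_Icc_self ht)
    have hvo : v t o ≠ 0 := norm_pos_iff.1 hc2
    -- abbreviations at time `t`
    set w : ι → ℂ := fun K => v t K / v t o with hw
    set q : ι → ℂ := fun J => w J - ρ t J with hq
    set u : ι → ℂ := fun J => ∑ K ∈ T, S J K * w K with hu
    set m : ℂ := ∑ K, S o K * w K with hm
    have hwo : w o = 1 := by simp only [hw]; exact div_self hvo
    have hsplit : ∀ J, ∑ K, S J K * w K = S J o + u J := by
      intro J; rw [← Finset.add_sum_erase _ _ (Finset.mem_univ o), hwo, mul_one]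
    -- derivative of each `q_J`, rewritten in terms of `q, u, m`
    set G : ι → ℂ := fun J => -(Λ : ℂ) * ((d J - d o : ℝ) : ℂ) * q J - (Λ : ℂ) * (g t : ℂ) * u J +
      (Λ : ℂ) * (g t : ℂ) * w J * m with hG
    have hqd : ∀ J ∈ T, HasDerivAt (fun t => v t J / v t o - ρ t J) (G J) t := by
      intro J hJ
      have h1 := hasDerivAt_ratio S d o Λ (g t) v t (hderiv t ht) hvo J
      have h2 := hρd t ht J (Finset.ne_of_mem_erase hJ)
      refine (h1.sub h2).congr_deriv ?_
      simp only [hG, hq, hm, hw] at *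
      rw [hsplit J]
      simp only [hu]
      ring
    have hY' : HasDerivAt Y (∑ J ∈ T, 2 * (conj (q J) * G J).re) t := by
      have : ∀ J ∈ T, HasDerivAt (fun t => ‖v t J / v t o - ρ t J‖ ^ 2) (2 * (conj (q J) * G J).re) t := by
        intro J hJ
        have h := (hqd J hJ).norm_sq
        simp only [Complex.inner, mul_comm (G J)] at h
        exact h
      simpa [hY] using HasDerivAt.fun_sum this
    refine ⟨_, hY', ?_⟩
    -- termwise bound, then Cauchy–Schwarz
    have hterm : ∀ J ∈ T, 2 * (conj (q J) * G J).re ≤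
        -2 * Λ * Δ * ‖q J‖ ^ 2 + 2 * Λ * gT * (‖q J‖ * ‖u J‖ + ‖m‖ * (‖q J‖ * ‖w J‖)) := by
      intro J hJ
      have hd : Δ ≤ d J - d o := by linarith [hΔ J (Finset.ne_of_mem_erase hJ)]
      have := two_re_remainder_le Λ Δ gT (g t) (d J - d o) (q J) (u J) (w J) m hΛ.le hd (hg t ht)
      simpa [hG] using this
    have hsum := Finset.sum_le_sum hterm
    -- norms of `w` off `o`, of `u`, of `m`
    have hW : ∑ K ∈ T, ‖w K‖ ^ 2 ≤ R ^ 2 := by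
      have : ∑ K ∈ T, ‖w K‖ ^ 2 = (∑ K ∈ T, ‖v t K‖ ^ 2) / ‖v t o‖ ^ 2 := by
        rw [Finset.sum_div]
        refine Finset.sum_congr rfl fun K _ => ?_
        simp only [hw]; rw [norm_div, div_pow]
      rw [this, div_le_iff₀ (by positivity)]
      exact hc1
    have hsqW : Real.sqrt (∑ K ∈ T, ‖w K‖ ^ 2) ≤ R := by
      calc Real.sqrt (∑ K ∈ T, ‖w K‖ ^ 2) ≤ Real.sqrt (R ^ 2) := Real.sqrt_le_sqrt hW
        _ = R := Real.sqrt_sq hR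
    have hU : Real.sqrt (∑ J ∈ T, ‖u J‖ ^ 2) ≤ σ * R := by
      have h1 : ∑ J ∈ T, ‖u J‖ ^ 2 ≤ σ ^ 2 * ∑ K ∈ T, ‖w K‖ ^ 2 := hσ w
      calc Real.sqrt (∑ J ∈ T, ‖u J‖ ^ 2) ≤ Real.sqrt (σ ^ 2 * ∑ K ∈ T, ‖w K‖ ^ 2) := Real.sqrt_le_sqrt h1
        _ = σ * Real.sqrt (∑ K ∈ T, ‖w K‖ ^ 2) := by rw [Real.sqrt_mul (sq_nonneg σ), Real.sqrt_sq hσ0]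
        _ ≤ σ * R := mul_le_mul_of_nonneg_left hsqW hσ0
    have hM : ‖m‖ ≤ ‖S o o‖ + γ * R := by
      have hm' : m = S o o + ∑ K ∈ T, S o K * w K := by
        simp only [hm]; rw [← Finset.add_sum_erase _ _ (Finset.mem_univ o), hwo, mul_one]
      rw [hm']
      refine (norm_add_le _ _).trans (add_le_add le_rfl ?_)
      have := norm_sum_mul_le_sqrt T (fun K => S o K) w
      rw [← hγ, Real.sqrt_sq hγ0] at this
      exact this.trans (mul_le_mul_of_nonneg_left hsqW hγ0)
    -- Cauchy–Schwarz on the two mixed sums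
    have hCS1 : ∑ J ∈ T, ‖q J‖ * ‖u J‖ ≤ Real.sqrt (Y t) * (σ * R) := by
      have h := sum_mul_le_sqrt T (fun J => ‖q J‖) (fun J => ‖u J‖)
      have hYt : ∑ J ∈ T, ‖q J‖ ^ 2 = Y t := by simp only [hY, hq, hw]
      rw [hYt] at h
      exact h.trans (mul_le_mul_of_nonneg_left hU (Real.sqrt_nonneg _))
    have hCS2 : ∑ J ∈ T, ‖q J‖ * ‖w J‖ ≤ Real.sqrt (Y t) * R := by
      have h := sum_mul_le_sqrt T (fun J => ‖q J‖) (fun J => ‖w J‖)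
      have hYt : ∑ J ∈ T, ‖q J‖ ^ 2 = Y t := by simp only [hY, hq, hw]
      rw [hYt] at h
      exact h.trans (mul_le_mul_of_nonneg_left hsqW (Real.sqrt_nonneg _))
    have hYt : ∑ J ∈ T, ‖q J‖ ^ 2 = Y t := by simp only [hY, hq, hw]
    -- assemble
    have hrhs : ∑ J ∈ T, (-2 * Λ * Δ * ‖q J‖ ^ 2 + 2 * Λ * gT * (‖q J‖ * ‖u J‖ + ‖m‖ * (‖q J‖ * ‖w J‖))) =
        -2 * Λ * Δ * Y t + 2 * Λ * gT * (∑ J ∈ T, ‖q J‖ * ‖u J‖ + ‖m‖ * ∑ J ∈ T, ‖q J‖ * ‖w J‖) := by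
      rw [Finset.sum_add_distrib, ← Finset.mul_sum, ← Finset.mul_sum, Finset.sum_add_distrib, ← Finset.mul_sum,
        hYt]
    rw [hrhs] at hsum
    have hmix : ∑ J ∈ T, ‖q J‖ * ‖u J‖ + ‖m‖ * ∑ J ∈ T, ‖q J‖ * ‖w J‖ ≤
        Real.sqrt (Y t) * (σ * R) + (‖S o o‖ + γ * R) * (Real.sqrt (Y t) * R) := by
      refine add_le_add hCS1 ?_
      exact mul_le_mul hM hCS2 (Finset.sum_nonneg fun J _ => by positivity) (by positivity)
    have h2Λ : (0 : ℝ) ≤ 2 * Λ * gT := by positivity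
    have := mul_le_mul_of_nonneg_left hmix h2Λ
    have hfinal : 2 * Λ * gT * (Real.sqrt (Y t) * (σ * R) + (‖S o o‖ + γ * R) * (Real.sqrt (Y t) * R)) =
        2 * Λ * Δ * Q * Real.sqrt (Y t) := by
      rw [show 2 * Λ * Δ * Q = 2 * Λ * (Δ * Q) by ring, hΔQ]; ring
    linarith [hsum, this, hfinal]
  -- contact argument at every level `ρ₁² > Q²`
  have hlevel : ∀ ρ₁ : ℝ, Q < ρ₁ → Y s ≤ ρ₁ ^ 2 := by
    intro ρ₁ hρ₁
    have hρ₁0 : 0 < ρ₁ := lt_of_le_of_lt hQ0 hρ₁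
    -- choose the derivative function pointwise
    choose! D hD using hYd
    refine le_of_contact_deriv_neg (f := Y) (f' := D) (C := ρ₁ ^ 2) hYc (fun t ht => (hD t ht).1)
      (by rw [hYa]; positivity) (fun t ht hYt => ?_) s hs
    have hle := (hD t ht).2
    rw [hYt, show Real.sqrt (ρ₁ ^ 2) = ρ₁ from Real.sqrt_sq hρ₁0.le] at hle
    have : -2 * Λ * Δ * ρ₁ ^ 2 + 2 * Λ * Δ * Q * ρ₁ = 2 * Λ * Δ * ρ₁ * (Q - ρ₁) := by ring
    rw [this] at hle
    exact lt_of_le_of_lt hle (mul_neg_of_pos_of_neg (by positivity) (by linarith))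
  -- let `ρ₁ ↓ Q`
  refine le_of_forall_gt_imp_ge_of_dense fun c hc => ?_
  have hc0 : 0 < c := lt_of_le_of_lt (sq_nonneg Q) hc
  have hQc : Q < Real.sqrt c := by
    calc Q = Real.sqrt (Q ^ 2) := (Real.sqrt_sq hQ0).symm
      _ < Real.sqrt c := Real.sqrt_lt_sqrt (sq_nonneg Q) hc
  have := hlevel (Real.sqrt c) hQc
  rwa [Real.sq_sqrt hc0.le] at this

/-- Row-sum (Schur) version of `ratio_remainder_le`: it suffices that every row and every column of the
fast–fast block `(S J K)_{J, K ≠ o}` has `ℓ¹`-norm `≤ σ` (for a tridiagonal ladder with entries of modulus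
`≤ 1`: `σ = 2`, uniformly in the truncation). [cite: Eastham1989, §1.5 Thm 1.5.1] [folklore: Schur test] -/
theorem ratio_remainder_le_of_rowSum (S : Matrix ι ι ℂ) (d : ι → ℝ) (o : ι) (Λ gT Δ γ R σ a b : ℝ)
    (g : ℝ → ℝ) (v ρ : ℝ → ι → ℂ) (hS : ∀ J K, S K J = -conj (S J K))
    (hγ : γ ^ 2 = ∑ K ∈ univ.erase o, ‖S o K‖ ^ 2) (hγ0 : 0 ≤ γ)
    (hΔ : ∀ J, J ≠ o → d o + Δ ≤ d J) (hΔ0 : 0 < Δ) (hΛ : 0 < Λ)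
    (hg : ∀ s ∈ Ioo a b, |g s| ≤ gT) (hgT : 0 ≤ gT) (hR : 0 ≤ R) (hσ0 : 0 ≤ σ)
    (hrow : ∀ J, J ≠ o → ∑ K ∈ univ.erase o, ‖S J K‖ ≤ σ)
    (hcont : ContinuousOn v (Icc a b))
    (hderiv : ∀ s ∈ Ioo a b, HasDerivAt v
        (fun J => -(Λ : ℂ) * ((d J : ℂ) * v s J + (g s : ℂ) * ∑ K, S J K * v s K)) s)
    (hcone : ∀ s ∈ Icc a b, ∑ J ∈ univ.erase o, ‖v s J‖ ^ 2 ≤ R ^ 2 * ‖v s o‖ ^ 2 ∧ 0 < ‖v s o‖)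
    (hρc : ∀ J, J ≠ o → ContinuousOn (fun t => ρ t J) (Icc a b))
    (hρd : ∀ s ∈ Ioo a b, ∀ J, J ≠ o → HasDerivAt (fun t => ρ t J)
        (-(Λ : ℂ) * (((d J - d o : ℝ) : ℂ) * ρ s J + (g s : ℂ) * S J o)) s)
    (hρa : ∀ J, J ≠ o → ρ a J = v a J / v a o) :
    ∀ s ∈ Icc a b, ∑ J ∈ univ.erase o, ‖v s J / v s o - ρ s J‖ ^ 2 ≤
      (gT * R * (σ + ‖S o o‖ + γ * R) / Δ) ^ 2 := by
  have hcol : ∀ K, K ≠ o → ∑ J ∈ univ.erase o, ‖S J K‖ ≤ σ := by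
    intro K hK
    have := hrow K hK
    refine le_trans (le_of_eq (Finset.sum_congr rfl fun J _ => ?_)) this
    rw [hS K J, norm_neg, Complex.norm_conj]
  exact ratio_remainder_le S d o Λ gT Δ γ R σ a b g v ρ hγ hγ0 hΔ hΔ0 hΛ hg hgT hR hσ0
    (sum_norm_sq_block_le_of_rowSum S o σ hrow hcol) hcont hderiv hcone hρc hρd hρa

/-! ## §6 The two-sided slow law to second order -/

/-- **Two-sided slow law with explicit second-order error.** Inside the invariant cone, with `ρ` and `Q` as in
`ratio_remainder_le` (its conclusion is hypothesis `hrem`), and `Φ` ANY function with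
`Φ' = g·Re Σ_{K≠o} S_{oK} ρ_K` on `(a,b)` (continuous on `[a,b]`):
`|log ‖v_o(s)‖² − log ‖v_o(a)‖² + 2Λ d_o (s − a) + 2Λ(Φ(s) − Φ(a))| ≤ 2Λ g_T γ Q (s − a)` on `[a,b]`.
For Duhamel responses (`re_sum_mul_duhamelMode`) `Φ = Λ Σ_{K≠o} ‖S_{oK}‖² ∫ g j_K`: the slow mode decays at the
bare rate plus the Taylor/Hartman–Wintner correction, up to a relative error `O(g_T σ/Δ)`.
[cite: Eastham1989, §1.5 Thm 1.5.1 (1.5.5), §1.6 Thm 1.6.1] -/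
theorem abs_log_slowEnergy_expansion_le (S : Matrix ι ι ℂ) (d : ι → ℝ) (o : ι) (Λ gT γ Q a b : ℝ)
    (g Φ : ℝ → ℝ) (v ρ : ℝ → ι → ℂ) (hS : ∀ J K, S K J = -conj (S J K))
    (hγ : γ ^ 2 = ∑ K ∈ univ.erase o, ‖S o K‖ ^ 2) (hγ0 : 0 ≤ γ) (hΛ : 0 < Λ)
    (hg : ∀ s ∈ Ioo a b, |g s| ≤ gT) (hQ0 : 0 ≤ Q)
    (hcont : ContinuousOn v (Icc a b))
    (hderiv : ∀ s ∈ Ioo a b, HasDerivAt v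
        (fun J => -(Λ : ℂ) * ((d J : ℂ) * v s J + (g s : ℂ) * ∑ K, S J K * v s K)) s)
    (hpos : ∀ s ∈ Icc a b, 0 < ‖v s o‖)
    (hrem : ∀ s ∈ Icc a b, ∑ J ∈ univ.erase o, ‖v s J / v s o - ρ s J‖ ^ 2 ≤ Q ^ 2)
    (hΦc : ContinuousOn Φ (Icc a b))
    (hΦd : ∀ s ∈ Ioo a b, HasDerivAt Φ (g s * (∑ K ∈ univ.erase o, S o K * ρ s K).re) s) :
    ∀ s ∈ Icc a b, |Real.log (‖v s o‖ ^ 2) - Real.log (‖v a o‖ ^ 2) + 2 * Λ * d o * (s - a) +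
        2 * Λ * (Φ s - Φ a)| ≤ 2 * Λ * gT * γ * Q * (s - a) := by
  intro s hs
  set T := (univ : Finset ι).erase o with hT
  set ψ : ℝ → ℝ := fun t => Real.log (‖v t o‖ ^ 2) + 2 * Λ * d o * (t - a) + 2 * Λ * Φ t with hψ
  set ψ' : ℝ → ℝ := fun t =>
    -2 * Λ * (g t * (∑ K ∈ T, S o K * (v t K / v t o - ρ t K)).re) with hψ'
  have hvJ : ∀ J, ContinuousOn (fun t => v t J) (Icc a b) := fun J => continuousOn_pi.1 hcont J
  have hψc : ContinuousOn ψ (Icc a b) := by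
    refine ContinuousOn.add (ContinuousOn.add (ContinuousOn.log (((hvJ o).norm).pow 2) fun t ht => ?_)
      (by fun_prop)) (hΦc.const_smul (2 * Λ) |>.congr fun t _ => by simp [smul_eq_mul])
    exact pow_ne_zero 2 (ne_of_gt (hpos t ht))
  have hψd : ∀ t ∈ Ioo a b, HasDerivAt ψ (ψ' t) t := by
    intro t ht
    have hvo : v t o ≠ 0 := norm_pos_iff.1 (hpos t (Ioo_subset_Icc_self ht))
    have h1 := hasDerivAt_log_slowEnergy S d o Λ (g t) v t hS (hderiv t ht) hvo
    have h2 : HasDerivAt (fun t => 2 * Λ * d o * (t - a)) (2 * Λ * d o) t := by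
      simpa using ((hasDerivAt_id t).sub_const a).const_mul (2 * Λ * d o)
    have h3 := (hΦd t ht).const_mul (2 * Λ)
    refine ((h1.add h2).add h3).congr_deriv ?_
    simp only [hψ']
    rw [show (∑ K ∈ T, S o K * (v t K / v t o - ρ t K)) =
        (∑ K ∈ T, S o K * (v t K / v t o)) - ∑ K ∈ T, S o K * ρ t K by
      rw [← Finset.sum_sub_distrib]; exact Finset.sum_congr rfl fun K _ => by ring, Complex.sub_re]
    ring
  have hbound : ∀ t ∈ Ioo a b, |ψ' t| ≤ 2 * Λ * gT * γ * Q := by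
    intro t ht
    have hq := hrem t (Ioo_subset_Icc_self ht)
    have hm : ‖∑ K ∈ T, S o K * (v t K / v t o - ρ t K)‖ ≤ γ * Q := by
      have := norm_sum_mul_le_sqrt T (fun K => S o K) (fun K => v t K / v t o - ρ t K)
      rw [← hγ, Real.sqrt_sq hγ0] at this
      refine this.trans (mul_le_mul_of_nonneg_left ?_ hγ0)
      calc Real.sqrt (∑ K ∈ T, ‖v t K / v t o - ρ t K‖ ^ 2) ≤ Real.sqrt (Q ^ 2) := Real.sqrt_le_sqrt hq
        _ = Q := Real.sqrt_sq hQ0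
    have hre : |(∑ K ∈ T, S o K * (v t K / v t o - ρ t K)).re| ≤ γ * Q :=
      (Complex.abs_re_le_norm _).trans hm
    have hprod : |g t * (∑ K ∈ T, S o K * (v t K / v t o - ρ t K)).re| ≤ gT * (γ * Q) := by
      rw [abs_mul]
      exact mul_le_mul (hg t ht) hre (abs_nonneg _) ((abs_nonneg _).trans (hg t ht))
    simp only [hψ']
    rw [abs_mul, show |(-2 : ℝ) * Λ| = 2 * Λ by rw [abs_mul, abs_neg, abs_two, abs_of_pos hΛ]]
    nlinarith [hprod, hΛ]
  have key := abs_sub_le_of_deriv_abs_le hψc hψd hbound s hs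
  have : ψ s - ψ a = Real.log (‖v s o‖ ^ 2) - Real.log (‖v a o‖ ^ 2) + 2 * Λ * d o * (s - a) +
      2 * Λ * (Φ s - Φ a) := by
    simp only [hψ]; ring
  rw [this] at key
  exact key

/-! ## §7 Data off the cone: two-time-scale amplitude bounds (the other columns of the propagator)

For data with a large fast part (e.g. the columns `e_J`, `J ≠ o`, of the slot propagator) the cone of §3 is not
available. The fast part then decays at the gap rate while feeding the slow mode by at most `O(g_T γ/Δ)` of
its size, and the slow mode thereafter grows at most at the Taylor rate `Λ g_T² γ²/Δ`. The proof is a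
comparison argument for the regularised amplitudes `√(θ² + ‖v_o‖²)`, `√(θ² + Σ_{J≠o}‖v_J‖²)` (METZLER 2 × 2
comparison system, handled through the one weighted combination that grows at the slow rate), `θ ↓ 0`.
[cite: KokotovicBensoussanBlankenship1987, Kokotović §2 Thm 2.3 and (2.16): the boundary-layer decomposition
`z = −L x + η`, `‖η‖ ≤ c₄ e^{−c₅ (t − t₀)/ε}`] -/

/-- `a ≤ b + ε c` for every `ε > 0` (with `c ≥ 0`) forces `a ≤ b`. [folklore] -/
private theorem le_of_forall_pos_le_add_mul' {x y c : ℝ} (hc : 0 ≤ c)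
    (h : ∀ η : ℝ, 0 < η → x ≤ y + η * c) : x ≤ y := by
  refine le_of_forall_pos_le_add fun η hη => ?_
  have h1 := h (η / (c + 1)) (by positivity)
  have h2 : η / (c + 1) * c ≤ η := by
    rw [div_mul_eq_mul_div, div_le_iff₀ (by positivity)]
    nlinarith
  linarith

/-- Grönwall with interior derivatives, non-negative rate: `f' ≤ K f + ε` on `(a,b)` (`K, ε ≥ 0`), `f` continuous on
`[a,b]` ⟹ `f x ≤ (f a + ε (x − a)) e^{K (x − a)}`. [folklore] -/
private theorem le_mul_exp_of_deriv_le_interior {f f' : ℝ → ℝ} {a b K ε : ℝ} (hfc : ContinuousOn f (Icc a b))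
    (hf' : ∀ x ∈ Ioo a b, HasDerivAt f (f' x) x) (hK : 0 ≤ K) (hε : 0 ≤ ε)
    (bound : ∀ x ∈ Ioo a b, f' x ≤ K * f x + ε) :
    ∀ x ∈ Icc a b, f x ≤ (f a + ε * (x - a)) * Real.exp (K * (x - a)) := by
  intro x hx
  have hxa : 0 ≤ x - a := sub_nonneg.2 hx.1
  refine le_of_forall_pos_le_add_mul' (c := (1 + (x - a)) * Real.exp (K * (x - a))) (by positivity) ?_
  intro η hη
  -- barrier `B y = (f a + η + (ε + η)(y − a)) e^{K (y − a)}`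
  set B : ℝ → ℝ := fun y => (f a + η + (ε + η) * (y - a)) * Real.exp (K * (y - a)) with hB
  set B' : ℝ → ℝ := fun y => (ε + η) * Real.exp (K * (y - a)) +
    (f a + η + (ε + η) * (y - a)) * (Real.exp (K * (y - a)) * K) with hB'
  have hBd : ∀ y, HasDerivAt B (B' y) y := by
    intro y
    have h1 : HasDerivAt (fun y => f a + η + (ε + η) * (y - a)) (ε + η) y := by
      simpa using (((hasDerivAt_id y).sub_const a).const_mul (ε + η)).const_add (f a + η)
    have h2 : HasDerivAt (fun y => Real.exp (K * (y - a))) (Real.exp (K * (y - a)) * K) y := by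
      simpa using (((hasDerivAt_id y).sub_const a).const_mul K).exp
    show HasDerivAt (fun y => (f a + η + (ε + η) * (y - a)) * Real.exp (K * (y - a))) _ y
    exact h1.mul h2
  have hF := le_of_contact_deriv_neg (f := fun y => f y - B y) (f' := fun y => f' y - B' y) (C := 0)
    (hfc.sub (fun y _ => (hBd y).continuousAt.continuousWithinAt))
    (fun y hy => (hf' y hy).sub (hBd y)) (by simp [hB]; linarith) ?_
  · have := hF x hx
    simp only [hB] at this
    have : f x ≤ (f a + η + (ε + η) * (x - a)) * Real.exp (K * (x - a)) := by linarith
    calc f x ≤ (f a + η + (ε + η) * (x - a)) * Real.exp (K * (x - a)) := this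
      _ = (f a + ε * (x - a)) * Real.exp (K * (x - a)) + η * ((1 + (x - a)) * Real.exp (K * (x - a))) := by
          ring
  · intro y hy hy0
    have hfy : f y = B y := by linarith
    have hya : 0 ≤ y - a := by linarith [hy.1]
    have hexp : 1 ≤ Real.exp (K * (y - a)) := Real.one_le_exp (mul_nonneg hK hya)
    simp only [hB']
    have hb := bound y hy
    rw [hfy] at hb
    simp only [hB] at hb ⊢
    nlinarith [hb, hexp, hη, hε]

/-- Grönwall with interior derivatives, negative rate: `f' ≤ −k f + c` on `(a,b)` (`k > 0`, `c ≥ 0`), `f` continuous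
on `[a,b]` ⟹ `f x ≤ f a · e^{−k (x − a)} + c/k`. [folklore] -/
private theorem le_exp_neg_add_of_deriv_le_interior {f f' : ℝ → ℝ} {a b k c : ℝ} (hfc : ContinuousOn f (Icc a b))
    (hf' : ∀ x ∈ Ioo a b, HasDerivAt f (f' x) x) (hk : 0 < k) (hc : 0 ≤ c)
    (bound : ∀ x ∈ Ioo a b, f' x ≤ -k * f x + c) :
    ∀ x ∈ Icc a b, f x ≤ f a * Real.exp (-k * (x - a)) + c / k := by
  intro x hx
  refine le_of_forall_pos_le_add_mul' (c := Real.exp (-k * (x - a)) + 1 / k) (by positivity) ?_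
  intro η hη
  -- barrier `B y = (f a + η) e^{−k(y−a)} + ((c + η)/k)(1 − e^{−k(y−a)})`
  set B : ℝ → ℝ := fun y => (f a + η) * Real.exp (-k * (y - a)) + (c + η) / k * (1 - Real.exp (-k * (y - a)))
    with hB
  set B' : ℝ → ℝ := fun y => (f a + η) * (Real.exp (-k * (y - a)) * (-k)) +
    (c + η) / k * (-(Real.exp (-k * (y - a)) * (-k))) with hB'
  have hBd : ∀ y, HasDerivAt B (B' y) y := by
    intro y
    have h2 : HasDerivAt (fun y => Real.exp (-k * (y - a))) (Real.exp (-k * (y - a)) * (-k)) y := by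
      simpa using (((hasDerivAt_id y).sub_const a).const_mul (-k)).exp
    show HasDerivAt (fun y => (f a + η) * Real.exp (-k * (y - a)) + (c + η) / k * (1 - Real.exp (-k * (y - a)))) _ y
    exact (h2.const_mul (f a + η)).add ((h2.const_sub 1).const_mul ((c + η) / k))
  have hF := le_of_contact_deriv_neg (f := fun y => f y - B y) (f' := fun y => f' y - B' y) (C := 0)
    (hfc.sub (fun y _ => (hBd y).continuousAt.continuousWithinAt))
    (fun y hy => (hf' y hy).sub (hBd y)) (by simp [hB]; linarith) ?_
  · have := hF x hx
    simp only [hB] at this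
    have hle1 : 1 - Real.exp (-k * (x - a)) ≤ 1 := by linarith [Real.exp_pos (-k * (x - a))]
    have h3 : (c + η) / k * (1 - Real.exp (-k * (x - a))) ≤ (c + η) / k :=
      mul_le_of_le_one_right (by positivity) hle1
    have h4 : (c + η) / k = c / k + η * (1 / k) := by ring
    nlinarith [this, h3, h4, Real.exp_pos (-k * (x - a)), hη]
  · intro y hy hy0
    have hfy : f y = B y := by linarith
    simp only [hB']
    have hb := bound y hy
    rw [hfy] at hb
    simp only [hB] at hb ⊢
    have hkk : (c + η) / k * k = c + η := div_mul_cancel₀ _ hk.ne'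
    nlinarith [hb, hkk, Real.exp_pos (-k * (y - a)), hη]

/-- The two energy inequalities behind the two-time-scale bounds: along the field, with `ε = Λ g_T γ`,
`(‖v_o‖²)' ≤ 2ε √(‖v_o‖²) √Z` (needs `d_o ≥ 0`) and `Z' ≤ −2ΛΔ Z + 2ε √(‖v_o‖²) √Z`, `Z = Σ_{J≠o}‖v_J‖²`.
[folklore] -/
private theorem slowFast_energy_ineq (S : Matrix ι ι ℂ) (d : ι → ℝ) (o : ι) (Λ gT Δ γ a b : ℝ)
    (g : ℝ → ℝ) (v : ℝ → ι → ℂ) (hS : ∀ J K, S K J = -conj (S J K))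
    (hγ : γ ^ 2 = ∑ K ∈ univ.erase o, ‖S o K‖ ^ 2) (hγ0 : 0 ≤ γ)
    (hΔ : ∀ J, J ≠ o → d o + Δ ≤ d J) (hd0 : 0 ≤ d o) (hΛ : 0 < Λ)
    (hg : ∀ s ∈ Ioo a b, |g s| ≤ gT) (hgT : 0 ≤ gT)
    (hderiv : ∀ s ∈ Ioo a b, HasDerivAt v
        (fun J => -(Λ : ℂ) * ((d J : ℂ) * v s J + (g s : ℂ) * ∑ K, S J K * v s K)) s) :
    ∀ t ∈ Ioo a b,
      (∃ D, HasDerivAt (fun t => ‖v t o‖ ^ 2) D t ∧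
        D ≤ 2 * (Λ * (gT * γ)) * (Real.sqrt (‖v t o‖ ^ 2) * Real.sqrt (∑ J ∈ univ.erase o, ‖v t J‖ ^ 2))) ∧
      (∃ D, HasDerivAt (fun t => ∑ J ∈ univ.erase o, ‖v t J‖ ^ 2) D t ∧
        D ≤ -2 * Λ * Δ * (∑ J ∈ univ.erase o, ‖v t J‖ ^ 2) +
          2 * (Λ * (gT * γ)) * (Real.sqrt (‖v t o‖ ^ 2) * Real.sqrt (∑ J ∈ univ.erase o, ‖v t J‖ ^ 2))) := by
  intro t ht
  have hE' := hasDerivAt_energy S d Λ (g t) v t hS (hderiv t ht)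
  have hA' := hasDerivAt_slowEnergy S d o Λ (g t) v t hS (hderiv t ht)
  set X : ℝ := (conj (v t o) * ∑ K ∈ univ.erase o, S o K * v t K).re with hX
  set Zt : ℝ := ∑ J ∈ univ.erase o, ‖v t J‖ ^ 2 with hZt
  have hZnn : 0 ≤ Zt := Finset.sum_nonneg fun J _ => by positivity
  have hXle : |X| ≤ Real.sqrt (‖v t o‖ ^ 2) * (γ * Real.sqrt Zt) := by
    have h1 : |X| ≤ ‖conj (v t o) * ∑ K ∈ univ.erase o, S o K * v t K‖ := Complex.abs_re_le_norm _
    rw [norm_mul, Complex.norm_conj] at h1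
    have h3 : ‖∑ K ∈ univ.erase o, S o K * v t K‖ ≤ γ * Real.sqrt Zt := by
      have := norm_sum_mul_le_sqrt (univ.erase o) (fun K => S o K) (fun K => v t K)
      rwa [← hγ, Real.sqrt_sq hγ0] at this
    rw [Real.sqrt_sq (norm_nonneg _)]
    exact h1.trans (mul_le_mul_of_nonneg_left h3 (norm_nonneg _))
  have hgX : |g t * X| ≤ gT * (Real.sqrt (‖v t o‖ ^ 2) * (γ * Real.sqrt Zt)) := by
    rw [abs_mul]; exact mul_le_mul (hg t ht) hXle (abs_nonneg _) hgT
  have h5 : -(g t * X) ≤ gT * (Real.sqrt (‖v t o‖ ^ 2) * (γ * Real.sqrt Zt)) := (neg_le_abs _).trans hgX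
  have h5' : g t * X ≤ gT * (Real.sqrt (‖v t o‖ ^ 2) * (γ * Real.sqrt Zt)) := (le_abs_self _).trans hgX
  -- `Z = E − A`
  have hZd : HasDerivAt (fun t => ∑ J ∈ univ.erase o, ‖v t J‖ ^ 2)
      (-2 * Λ * ∑ J, d J * ‖v t J‖ ^ 2 - -2 * Λ * (d o * ‖v t o‖ ^ 2 + g t * X)) t := by
    have hZE : (fun t => ∑ J ∈ univ.erase o, ‖v t J‖ ^ 2) = fun t => (∑ J, ‖v t J‖ ^ 2) - ‖v t o‖ ^ 2 := by
      funext t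
      rw [← Finset.add_sum_erase _ _ (Finset.mem_univ o)]
      ring
    rw [hZE]
    exact hE'.sub hA'
  refine ⟨⟨_, hA', ?_⟩, ⟨_, hZd, ?_⟩⟩
  · have h6 : 0 ≤ d o * ‖v t o‖ ^ 2 := by positivity
    nlinarith [h5, h6, hΛ]
  · have hsumd : d o * ‖v t o‖ ^ 2 + (d o + Δ) * Zt ≤ ∑ J, d J * ‖v t J‖ ^ 2 := by
      rw [← Finset.add_sum_erase _ _ (Finset.mem_univ o), hZt, Finset.mul_sum]
      refine add_le_add le_rfl (Finset.sum_le_sum fun J hJ => ?_)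
      exact mul_le_mul_of_nonneg_right (hΔ J (Finset.ne_of_mem_erase hJ)) (by positivity)
    have h7 : 0 ≤ d o * Zt := mul_nonneg hd0 hZnn
    nlinarith [h5', hsumd, h7, hΛ]

/-- Regularised amplitudes: from the two energy inequalities, for `θ > 0` the functions `α = √(θ² + A)`,
`ζ = √(θ² + Z)` satisfy `α' ≤ ε ζ` and `ζ' ≤ −L ζ + L θ + ε α` (`2L` the fast energy rate). [folklore] -/
private theorem regAmp_deriv_bounds {A Z : ℝ → ℝ} {a b ε L θ : ℝ} (hθ : 0 < θ) (hε : 0 ≤ ε) (hL : 0 ≤ L)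
    (hAnn : ∀ t, 0 ≤ A t) (hZnn : ∀ t, 0 ≤ Z t)
    (hA' : ∀ t ∈ Ioo a b, ∃ D, HasDerivAt A D t ∧ D ≤ 2 * ε * (Real.sqrt (A t) * Real.sqrt (Z t)))
    (hZ' : ∀ t ∈ Ioo a b, ∃ D, HasDerivAt Z D t ∧
      D ≤ -2 * L * Z t + 2 * ε * (Real.sqrt (A t) * Real.sqrt (Z t))) :
    (∀ t ∈ Ioo a b, ∃ D, HasDerivAt (fun t => Real.sqrt (θ ^ 2 + A t)) D t ∧
        D ≤ ε * Real.sqrt (θ ^ 2 + Z t)) ∧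
      (∀ t ∈ Ioo a b, ∃ D, HasDerivAt (fun t => Real.sqrt (θ ^ 2 + Z t)) D t ∧
        D ≤ -L * Real.sqrt (θ ^ 2 + Z t) + L * θ + ε * Real.sqrt (θ ^ 2 + A t)) := by
  set α : ℝ → ℝ := fun t => Real.sqrt (θ ^ 2 + A t) with hα
  set ζ : ℝ → ℝ := fun t => Real.sqrt (θ ^ 2 + Z t) with hζ
  have hαpos : ∀ t, 0 < α t := fun t => Real.sqrt_pos.2 (add_pos_of_pos_of_nonneg (pow_pos hθ 2) (hAnn t))
  have hζpos : ∀ t, 0 < ζ t := fun t => Real.sqrt_pos.2 (add_pos_of_pos_of_nonneg (pow_pos hθ 2) (hZnn t))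
  have hθζ : ∀ t, θ ≤ ζ t := fun t => by
    calc θ = Real.sqrt (θ ^ 2) := (Real.sqrt_sq hθ.le).symm
      _ ≤ Real.sqrt (θ ^ 2 + Z t) := Real.sqrt_le_sqrt (by linarith [hZnn t])
  have hAα : ∀ t, Real.sqrt (A t) ≤ α t := fun t => Real.sqrt_le_sqrt (by nlinarith)
  have hZζ : ∀ t, Real.sqrt (Z t) ≤ ζ t := fun t => Real.sqrt_le_sqrt (by nlinarith)
  have hζ2 : ∀ t, ζ t ^ 2 = θ ^ 2 + Z t := fun t => Real.sq_sqrt (add_nonneg (sq_nonneg θ) (hZnn t))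
  refine ⟨fun t ht => ?_, fun t ht => ?_⟩
  · obtain ⟨DA, hDA, hDAle⟩ := hA' t ht
    have hne : θ ^ 2 + A t ≠ 0 := ne_of_gt (add_pos_of_pos_of_nonneg (pow_pos hθ 2) (hAnn t))
    refine ⟨DA / (2 * Real.sqrt (θ ^ 2 + A t)), (hDA.const_add (θ ^ 2)).sqrt hne, ?_⟩
    change DA / (2 * α t) ≤ ε * ζ t
    rw [div_le_iff₀ (mul_pos two_pos (hαpos t))]
    have h1 : Real.sqrt (A t) * Real.sqrt (Z t) ≤ α t * ζ t :=
      mul_le_mul (hAα t) (hZζ t) (Real.sqrt_nonneg _) (hαpos t).le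
    nlinarith [hDAle, h1, hε]
  · obtain ⟨DZ, hDZ, hDZle⟩ := hZ' t ht
    have hne : θ ^ 2 + Z t ≠ 0 := ne_of_gt (add_pos_of_pos_of_nonneg (pow_pos hθ 2) (hZnn t))
    refine ⟨DZ / (2 * Real.sqrt (θ ^ 2 + Z t)), (hDZ.const_add (θ ^ 2)).sqrt hne, ?_⟩
    change DZ / (2 * ζ t) ≤ -L * ζ t + L * θ + ε * α t
    rw [div_le_iff₀ (mul_pos two_pos (hζpos t))]
    have h1 : Real.sqrt (A t) * Real.sqrt (Z t) ≤ α t * ζ t :=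
      mul_le_mul (hAα t) (hZζ t) (Real.sqrt_nonneg _) (hαpos t).le
    have h2 : -2 * L * Z t = -2 * L * (ζ t ^ 2 - θ ^ 2) := by rw [hζ2]; ring
    have h3 : θ ^ 2 ≤ θ * ζ t := by nlinarith [hθζ t]
    have h4 := mul_le_mul_of_nonneg_left h3 (by positivity : (0 : ℝ) ≤ 2 * L)
    have h5 := mul_le_mul_of_nonneg_left h1 (by positivity : (0 : ℝ) ≤ 2 * ε)
    have e : (-L * ζ t + L * θ + ε * α t) * (2 * ζ t) =
        -2 * L * (ζ t ^ 2 - θ ^ 2) - 2 * L * θ ^ 2 + 2 * L * (θ * ζ t) + 2 * ε * (α t * ζ t) := by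
      ring
    rw [e]
    linarith [hDZle, h2, h4, h5]

/-- **Fast-to-slow feed (the slow entry of the other columns).** With gap `d J ≥ d o + Δ` (`Δ > 0`), `d o ≥ 0`,
coupling `|g| ≤ g_T` and `γ² = Σ_{K≠o}‖S o K‖²`, every trajectory satisfies on `[a,b]`
`‖v_o(s)‖ ≤ exp(Λ (g_T γ)² (s − a)/Δ) · (‖v_o(a)‖ + (g_T γ/Δ) √(Σ_{J≠o} ‖v_J(a)‖²))`:
fast data of unit size feed the slow mode by at most `g_T γ/Δ`, up to the slow Taylor growth rate
`Λ g_T² γ²/Δ`. No cone condition is needed. [cite: KokotovicBensoussanBlankenship1987, Kokotović §2 Thm 2.3, (2.16)]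
[cite: Eastham1989, §1.4 (1.4.22)–(1.4.30)] -/
theorem norm_slow_le_of_gap (S : Matrix ι ι ℂ) (d : ι → ℝ) (o : ι) (Λ gT Δ γ a b : ℝ) (g : ℝ → ℝ)
    (v : ℝ → ι → ℂ) (hS : ∀ J K, S K J = -conj (S J K))
    (hγ : γ ^ 2 = ∑ K ∈ univ.erase o, ‖S o K‖ ^ 2) (hγ0 : 0 ≤ γ)
    (hΔ : ∀ J, J ≠ o → d o + Δ ≤ d J) (hΔ0 : 0 < Δ) (hd0 : 0 ≤ d o) (hΛ : 0 < Λ)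
    (hg : ∀ s ∈ Ioo a b, |g s| ≤ gT) (hgT : 0 ≤ gT)
    (hcont : ContinuousOn v (Icc a b))
    (hderiv : ∀ s ∈ Ioo a b, HasDerivAt v
        (fun J => -(Λ : ℂ) * ((d J : ℂ) * v s J + (g s : ℂ) * ∑ K, S J K * v s K)) s) :
    ∀ s ∈ Icc a b, ‖v s o‖ ≤ Real.exp (Λ * (gT * γ) ^ 2 / Δ * (s - a)) *
      (‖v a o‖ + gT * γ / Δ * Real.sqrt (∑ J ∈ univ.erase o, ‖v a J‖ ^ 2)) := by
  have hAZ := slowFast_energy_ineq S d o Λ gT Δ γ a b g v hS hγ hγ0 hΔ hd0 hΛ hg hgT hderiv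
  -- notation
  set A : ℝ → ℝ := fun t => ‖v t o‖ ^ 2 with hA
  set Z : ℝ → ℝ := fun t => ∑ J ∈ univ.erase o, ‖v t J‖ ^ 2 with hZ
  set ε : ℝ := Λ * (gT * γ) with hε
  have hA' : ∀ t ∈ Ioo a b, ∃ D, HasDerivAt A D t ∧ D ≤ 2 * ε * (Real.sqrt (A t) * Real.sqrt (Z t)) :=
    fun t ht => (hAZ t ht).1
  have hZ' : ∀ t ∈ Ioo a b, ∃ D, HasDerivAt Z D t ∧
      D ≤ -2 * (Λ * Δ) * Z t + 2 * ε * (Real.sqrt (A t) * Real.sqrt (Z t)) := by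
    intro t ht
    obtain ⟨D, hD, hle⟩ := (hAZ t ht).2
    refine ⟨D, hD, ?_⟩
    have e : -2 * (Λ * Δ) * Z t = -2 * Λ * Δ * Z t := by ring
    rw [e]
    exact hle
  have hZnn : ∀ t, 0 ≤ Z t := fun t => Finset.sum_nonneg fun J _ => by positivity
  have hAnn : ∀ t, 0 ≤ A t := fun t => by positivity
  have hvJ : ∀ J, ContinuousOn (fun t => v t J) (Icc a b) := fun J => continuousOn_pi.1 hcont J
  have hAc : ContinuousOn A (Icc a b) := ((hvJ o).norm).pow 2
  have hZc : ContinuousOn Z (Icc a b) := continuousOn_finsetSum _ fun J _ => ((hvJ J).norm).pow 2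
  have hε0 : 0 ≤ ε := by positivity
  intro s hs
  rcases le_or_gt b a with hba | hab
  · have hsa : s = a := le_antisymm (le_trans hs.2 hba) hs.1
    subst hsa
    simp only [sub_self, mul_zero, Real.exp_zero, one_mul]
    have : 0 ≤ gT * γ / Δ * Real.sqrt (∑ J ∈ univ.erase o, ‖v s J‖ ^ 2) := by positivity
    linarith
  have main : ∀ θ : ℝ, 0 < θ → ‖v s o‖ ≤ Real.exp (Λ * (gT * γ) ^ 2 / Δ * (s - a)) *
      (‖v a o‖ + gT * γ / Δ * Real.sqrt (Z a)) +
      θ * (Real.exp (Λ * (gT * γ) ^ 2 / Δ * (s - a)) * (1 + gT * γ / Δ + Λ * Δ * (s - a) * (gT * γ / Δ))) := by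
    intro θ hθ
    obtain ⟨hα', hζ'⟩ := regAmp_deriv_bounds (a := a) (b := b) hθ hε0 (by positivity : (0 : ℝ) ≤ Λ * Δ)
      hAnn hZnn hA' hZ'
    set α : ℝ → ℝ := fun t => Real.sqrt (θ ^ 2 + A t) with hα
    set ζ : ℝ → ℝ := fun t => Real.sqrt (θ ^ 2 + Z t) with hζ
    have hζpos : ∀ t, 0 < ζ t := fun t => Real.sqrt_pos.2 (add_pos_of_pos_of_nonneg (pow_pos hθ 2) (hZnn t))
    have hAα : ∀ t, Real.sqrt (A t) ≤ α t := fun t => Real.sqrt_le_sqrt (by nlinarith)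
    have hαc : ContinuousOn α (Icc a b) := (continuousOn_const.add hAc).sqrt
    have hζc : ContinuousOn ζ (Icc a b) := (continuousOn_const.add hZc).sqrt
    -- trivial case `ε = 0`: the slow energy does not increase
    rcases eq_or_lt_of_le hε0 with hε00 | hεpos
    · -- `A' ≤ 0`
      have hAmono : AntitoneOn A (Icc a b) := by
        refine antitoneOn_of_deriv_nonpos (convex_Icc a b) hAc ?_ ?_
        · rw [interior_Icc]; intro t ht
          obtain ⟨D, hD, -⟩ := hA' t ht; exact hD.differentiableAt.differentiableWithinAt
        · rw [interior_Icc]; intro t ht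
          obtain ⟨D, hD, hDle⟩ := hA' t ht
          rw [hD.deriv, ← hε00] at *
          simpa using hDle
      have h1 : A s ≤ A a := hAmono (left_mem_Icc.2 hab.le) hs hs.1
      have h2 : ‖v s o‖ ≤ ‖v a o‖ := by
        have := Real.sqrt_le_sqrt h1
        simp only [hA, Real.sqrt_sq (norm_nonneg _)] at this
        exact this
      have h3 : 1 ≤ Real.exp (Λ * (gT * γ) ^ 2 / Δ * (s - a)) :=
        Real.one_le_exp (mul_nonneg (by positivity) (sub_nonneg.2 hs.1))
      have h4 : 0 ≤ gT * γ / Δ * Real.sqrt (Z a) := by positivity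
      have h5 : 0 ≤ θ * (Real.exp (Λ * (gT * γ) ^ 2 / Δ * (s - a)) *
          (1 + gT * γ / Δ + Λ * Δ * (s - a) * (gT * γ / Δ))) := by
        have : 0 ≤ s - a := sub_nonneg.2 hs.1
        positivity
      have h6 : ‖v a o‖ ≤ Real.exp (Λ * (gT * γ) ^ 2 / Δ * (s - a)) * ‖v a o‖ :=
        le_mul_of_one_le_left (norm_nonneg _) h3
      have h7 : 0 ≤ Real.exp (Λ * (gT * γ) ^ 2 / Δ * (s - a)) * (gT * γ / Δ * Real.sqrt (Z a)) := by positivity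
      have e : Real.exp (Λ * (gT * γ) ^ 2 / Δ * (s - a)) * (‖v a o‖ + gT * γ / Δ * Real.sqrt (Z a)) =
          Real.exp (Λ * (gT * γ) ^ 2 / Δ * (s - a)) * ‖v a o‖ +
            Real.exp (Λ * (gT * γ) ^ 2 / Δ * (s - a)) * (gT * γ / Δ * Real.sqrt (Z a)) := by ring
      rw [e]
      linarith [h2, h6, h7, h5]
    -- main case `ε > 0`: `Ψ = ζ + κ α`, `κ = ΛΔ/ε`, grows at most at rate `μ = ε²/(ΛΔ)`
    set κ : ℝ := Λ * Δ / ε with hκ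
    set μ : ℝ := ε ^ 2 / (Λ * Δ) with hμ
    have hκpos : 0 < κ := by positivity
    have hμ0 : 0 ≤ μ := by positivity
    have hκε : κ * ε = Λ * Δ := by rw [hκ]; field_simp
    have hμκ : μ * κ = ε := by rw [hμ, hκ]; field_simp
    set Ψ : ℝ → ℝ := fun t => ζ t + κ * α t with hΨ
    have hΨc : ContinuousOn Ψ (Icc a b) := hζc.add (hαc.const_smul κ |>.congr fun t _ => by simp [smul_eq_mul])
    have hΨ' : ∀ t ∈ Ioo a b, ∃ D, HasDerivAt Ψ D t ∧ D ≤ μ * Ψ t + Λ * Δ * θ := by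
      intro t ht
      obtain ⟨Dα, hDα, hDαle⟩ := hα' t ht
      obtain ⟨Dζ, hDζ, hDζle⟩ := hζ' t ht
      refine ⟨Dζ + κ * Dα, hDζ.add (hDα.const_mul κ), ?_⟩
      have h1 : κ * Dα ≤ Λ * Δ * ζ t := by
        calc κ * Dα ≤ κ * (ε * ζ t) := mul_le_mul_of_nonneg_left hDαle hκpos.le
          _ = (κ * ε) * ζ t := by ring
          _ = Λ * Δ * ζ t := by rw [hκε]
      have h2 : 0 ≤ μ * ζ t := mul_nonneg hμ0 (hζpos t).le
      have h3 : μ * (ζ t + κ * α t) = μ * ζ t + ε * α t := by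
        rw [mul_add, ← mul_assoc, hμκ]
      simp only [hΨ]
      rw [h3]
      linarith [hDζle, h1, h2]
    choose! DΨ hDΨ using hΨ'
    have hgron := le_mul_exp_of_deriv_le_interior (f := Ψ) (f' := DΨ) hΨc (fun t ht => (hDΨ t ht).1) hμ0
      (by positivity) (fun t ht => (hDΨ t ht).2) s hs
    -- unwind: `‖v s o‖ ≤ α s ≤ Ψ s / κ`
    have hvα : ‖v s o‖ ≤ α s := by
      have := hAα s; simp only [hA, Real.sqrt_sq (norm_nonneg _)] at this; exact this
    have hαΨ : α s ≤ Ψ s / κ := by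
      rw [le_div_iff₀ hκpos]; simp only [hΨ]; nlinarith [(hζpos s).le]
    have hΨa : Ψ a ≤ (θ + Real.sqrt (Z a)) + κ * (θ + ‖v a o‖) := by
      simp only [hΨ, hζ, hα, hA]
      have e1 : Real.sqrt (θ ^ 2 + Z a) ≤ θ + Real.sqrt (Z a) := by
        rw [Real.sqrt_le_left (by positivity)]
        nlinarith [Real.sq_sqrt (hZnn a), Real.sqrt_nonneg (Z a), hθ.le]
      have e2 : Real.sqrt (θ ^ 2 + ‖v a o‖ ^ 2) ≤ θ + ‖v a o‖ := by
        rw [Real.sqrt_le_left (by positivity)]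
        nlinarith [norm_nonneg (v a o), hθ.le]
      have e3 := mul_le_mul_of_nonneg_left e2 hκpos.le
      linarith [e1, e3]
    have hexp_eq : Real.exp (μ * (s - a)) = Real.exp (Λ * (gT * γ) ^ 2 / Δ * (s - a)) := by
      congr 1; rw [hμ, hε]; field_simp
    have hsa : 0 ≤ s - a := sub_nonneg.2 hs.1
    have hexp1 : 0 < Real.exp (μ * (s - a)) := Real.exp_pos _
    -- `Ψ s / κ ≤ e^{μτ} (Ψ a + ΛΔθτ)/κ` and `1/κ = ε/(ΛΔ) = gTγ/Δ`
    have hκne : κ ≠ 0 := hκpos.ne'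
    have hinvκ : 1 / κ = gT * γ / Δ := by rw [hκ, hε]; field_simp
    have step1 : ‖v s o‖ ≤ ((θ + Real.sqrt (Z a)) + κ * (θ + ‖v a o‖) + Λ * Δ * θ * (s - a)) *
        Real.exp (μ * (s - a)) / κ := by
      have h1 : Ψ s / κ ≤ (Ψ a + Λ * Δ * θ * (s - a)) * Real.exp (μ * (s - a)) / κ :=
        div_le_div_of_nonneg_right hgron hκpos.le
      have h2 : (Ψ a + Λ * Δ * θ * (s - a)) * Real.exp (μ * (s - a)) / κ ≤
          ((θ + Real.sqrt (Z a)) + κ * (θ + ‖v a o‖) + Λ * Δ * θ * (s - a)) * Real.exp (μ * (s - a)) / κ := by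
        apply div_le_div_of_nonneg_right _ hκpos.le
        exact mul_le_mul_of_nonneg_right (by linarith [hΨa]) hexp1.le
      exact (hvα.trans hαΨ).trans (h1.trans h2)
    have step2 : ((θ + Real.sqrt (Z a)) + κ * (θ + ‖v a o‖) + Λ * Δ * θ * (s - a)) *
        Real.exp (μ * (s - a)) / κ =
        Real.exp (μ * (s - a)) * (‖v a o‖ + (1 / κ) * Real.sqrt (Z a)) +
          θ * (Real.exp (μ * (s - a)) * (1 + 1 / κ + Λ * Δ * (s - a) * (1 / κ))) := by
      field_simp
      ring
    rw [step2, hexp_eq, hinvκ] at step1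
    exact step1
  have hC : 0 ≤ Real.exp (Λ * (gT * γ) ^ 2 / Δ * (s - a)) *
      (1 + gT * γ / Δ + Λ * Δ * (s - a) * (gT * γ / Δ)) := by
    have : 0 ≤ s - a := sub_nonneg.2 hs.1
    positivity
  exact le_of_forall_pos_le_add_mul' hC main

/-- **Decay of the fast part off the cone (the fast entries of the other columns).** Under the hypotheses of
`norm_slow_le_of_gap`, on `[a,b]`:
`√(Σ_{J≠o}‖v_J(s)‖²) ≤ e^{−ΛΔ(s−a)} √(Σ_{J≠o}‖v_J(a)‖²) + (g_T γ/Δ)·e^{Λ(g_Tγ)²(s−a)/Δ}(‖v_o(a)‖ + (g_Tγ/Δ)√(Σ_{J≠o}‖v_J(a)‖²))`: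
the fast part relaxes at the gap rate down to the slaved level `(g_T γ/Δ)·(slow amplitude)` — the
boundary-layer term `η` of the Riccati decomposition `z = −Lx + η`.
[cite: KokotovicBensoussanBlankenship1987, Kokotović §2 (2.16)–(2.20), Thm 2.3] -/
theorem sqrt_fast_le_of_gap (S : Matrix ι ι ℂ) (d : ι → ℝ) (o : ι) (Λ gT Δ γ a b : ℝ) (g : ℝ → ℝ)
    (v : ℝ → ι → ℂ) (hS : ∀ J K, S K J = -conj (S J K))
    (hγ : γ ^ 2 = ∑ K ∈ univ.erase o, ‖S o K‖ ^ 2) (hγ0 : 0 ≤ γ)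
    (hΔ : ∀ J, J ≠ o → d o + Δ ≤ d J) (hΔ0 : 0 < Δ) (hd0 : 0 ≤ d o) (hΛ : 0 < Λ)
    (hg : ∀ s ∈ Ioo a b, |g s| ≤ gT) (hgT : 0 ≤ gT)
    (hcont : ContinuousOn v (Icc a b))
    (hderiv : ∀ s ∈ Ioo a b, HasDerivAt v
        (fun J => -(Λ : ℂ) * ((d J : ℂ) * v s J + (g s : ℂ) * ∑ K, S J K * v s K)) s) :
    ∀ s ∈ Icc a b, Real.sqrt (∑ J ∈ univ.erase o, ‖v s J‖ ^ 2) ≤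
      Real.exp (-(Λ * Δ) * (s - a)) * Real.sqrt (∑ J ∈ univ.erase o, ‖v a J‖ ^ 2) +
        gT * γ / Δ * (Real.exp (Λ * (gT * γ) ^ 2 / Δ * (s - a)) *
          (‖v a o‖ + gT * γ / Δ * Real.sqrt (∑ J ∈ univ.erase o, ‖v a J‖ ^ 2))) := by
  have hAZ := slowFast_energy_ineq S d o Λ gT Δ γ a b g v hS hγ hγ0 hΔ hd0 hΛ hg hgT hderiv
  have hslow := norm_slow_le_of_gap S d o Λ gT Δ γ a b g v hS hγ hγ0 hΔ hΔ0 hd0 hΛ hg hgT hcont hderiv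
  -- notation
  set A : ℝ → ℝ := fun t => ‖v t o‖ ^ 2 with hA
  set Z : ℝ → ℝ := fun t => ∑ J ∈ univ.erase o, ‖v t J‖ ^ 2 with hZ
  set ε : ℝ := Λ * (gT * γ) with hε
  set M : ℝ → ℝ := fun t => Real.exp (Λ * (gT * γ) ^ 2 / Δ * (t - a)) *
    (‖v a o‖ + gT * γ / Δ * Real.sqrt (Z a)) with hM
  have hA' : ∀ t ∈ Ioo a b, ∃ D, HasDerivAt A D t ∧ D ≤ 2 * ε * (Real.sqrt (A t) * Real.sqrt (Z t)) :=
    fun t ht => (hAZ t ht).1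
  have hZ' : ∀ t ∈ Ioo a b, ∃ D, HasDerivAt Z D t ∧
      D ≤ -2 * (Λ * Δ) * Z t + 2 * ε * (Real.sqrt (A t) * Real.sqrt (Z t)) := by
    intro t ht
    obtain ⟨D, hD, hle⟩ := (hAZ t ht).2
    refine ⟨D, hD, ?_⟩
    have e : -2 * (Λ * Δ) * Z t = -2 * Λ * Δ * Z t := by ring
    rw [e]
    exact hle
  have hZnn : ∀ t, 0 ≤ Z t := fun t => Finset.sum_nonneg fun J _ => by positivity
  have hAnn : ∀ t, 0 ≤ A t := fun t => by positivity
  have hvJ : ∀ J, ContinuousOn (fun t => v t J) (Icc a b) := fun J => continuousOn_pi.1 hcont J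
  have hZc : ContinuousOn Z (Icc a b) := continuousOn_finsetSum _ fun J _ => ((hvJ J).norm).pow 2
  have hε0 : 0 ≤ ε := by positivity
  have hMnn : ∀ t, 0 ≤ M t := fun t => by positivity
  have hMmono : ∀ t t', t ≤ t' → M t ≤ M t' := by
    intro t t' htt'
    simp only [hM]
    refine mul_le_mul_of_nonneg_right (Real.exp_le_exp.2 ?_) (by positivity)
    exact mul_le_mul_of_nonneg_left (by linarith) (by positivity)
  intro s hs
  show Real.sqrt (Z s) ≤ Real.exp (-(Λ * Δ) * (s - a)) * Real.sqrt (Z a) + gT * γ / Δ * M s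
  rcases le_or_gt b a with hba | hab
  · have hsa : s = a := le_antisymm (le_trans hs.2 hba) hs.1
    subst hsa
    simp only [sub_self, mul_zero, Real.exp_zero, one_mul]
    have : 0 ≤ gT * γ / Δ * M s := by positivity
    linarith
  have main : ∀ θ : ℝ, 0 < θ → Real.sqrt (Z s) ≤
      Real.exp (-(Λ * Δ) * (s - a)) * Real.sqrt (Z a) + gT * γ / Δ * M s +
        θ * (Real.exp (-(Λ * Δ) * (s - a)) + 1 + gT * γ / Δ) := by
    intro θ hθ
    obtain ⟨-, hζ'⟩ := regAmp_deriv_bounds (a := a) (b := b) hθ hε0 (by positivity : (0 : ℝ) ≤ Λ * Δ)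
      hAnn hZnn hA' hZ'
    set ζ : ℝ → ℝ := fun t => Real.sqrt (θ ^ 2 + Z t) with hζ
    have hζc : ContinuousOn ζ (Icc a s) := ((continuousOn_const.add hZc).sqrt).mono (Icc_subset_Icc le_rfl hs.2)
    -- on `[a, s]`: `α t ≤ θ + ‖v t o‖ ≤ θ + M s`
    have hαle : ∀ t ∈ Ioo a s, Real.sqrt (θ ^ 2 + A t) ≤ θ + M s := by
      intro t ht
      have htI : t ∈ Icc a b := ⟨ht.1.le, ht.2.le.trans hs.2⟩
      have e2 : Real.sqrt (θ ^ 2 + A t) ≤ θ + ‖v t o‖ := by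
        rw [Real.sqrt_le_left (by positivity)]
        simp only [hA]
        nlinarith [norm_nonneg (v t o), hθ.le]
      have e3 : ‖v t o‖ ≤ M s := (hslow t htI).trans (hMmono t s ht.2.le)
      linarith
    set c : ℝ := Λ * Δ * θ + ε * (θ + M s) with hc
    have hc0 : 0 ≤ c := by positivity
    choose! Dζ hDζ using hζ'
    have hkey := le_exp_neg_add_of_deriv_le_interior (f := ζ) (f' := Dζ) (a := a) (b := s) (k := Λ * Δ) (c := c) hζc
      (fun t ht => (hDζ t ⟨ht.1, ht.2.trans_le hs.2⟩).1) (by positivity) hc0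
      (fun t ht => by
        have h := (hDζ t ⟨ht.1, ht.2.trans_le hs.2⟩).2
        have h2 := mul_le_mul_of_nonneg_left (hαle t ht) hε0
        simp only [hc]
        linarith) s ⟨hs.1, le_rfl⟩
    -- unwind
    have h1 : Real.sqrt (Z s) ≤ ζ s := Real.sqrt_le_sqrt (by nlinarith)
    have h2 : ζ a ≤ θ + Real.sqrt (Z a) := by
      simp only [hζ]
      rw [Real.sqrt_le_left (by positivity)]
      nlinarith [Real.sq_sqrt (hZnn a), Real.sqrt_nonneg (Z a), hθ.le]
    have hexp0 : 0 < Real.exp (-(Λ * Δ) * (s - a)) := Real.exp_pos _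
    have h3 : ζ a * Real.exp (-(Λ * Δ) * (s - a)) ≤ (θ + Real.sqrt (Z a)) * Real.exp (-(Λ * Δ) * (s - a)) :=
      mul_le_mul_of_nonneg_right h2 hexp0.le
    have h4 : c / (Λ * Δ) = θ + gT * γ / Δ * (θ + M s) := by
      simp only [hc, hε]; field_simp
    rw [h4] at hkey
    nlinarith [h1, hkey, h3, hexp0, hMnn s, hθ]
  have hC : 0 ≤ Real.exp (-(Λ * Δ) * (s - a)) + 1 + gT * γ / Δ := by positivity
  exact le_of_forall_pos_le_add_mul' hC main

/-! ## §8 Linearity: uniqueness and superposition (splitting a datum into its column and its fast part)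

The system is linear with bounded coefficients on a finite-dimensional space, so trajectories are determined by
their data (forward uniqueness from the energy identity and the crude rate bound `Σ_J |d_J|`), and a datum may be
split into its slow column and its fast part, to which §3–§6 and §7 apply separately. [folklore] -/

omit [DecidableEq ι] in
/-- The difference of two trajectories of `v' = −Λ(Dv + g S v)` is a trajectory. [folklore] -/
private theorem hasDerivAt_field_sub (S : Matrix ι ι ℂ) (d : ι → ℝ) (Λ gs : ℝ) (v w : ℝ → ι → ℂ) (s : ℝ)
    (hv : HasDerivAt v (fun J => -(Λ : ℂ) * ((d J : ℂ) * v s J + (gs : ℂ) * ∑ K, S J K * v s K)) s)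
    (hw : HasDerivAt w (fun J => -(Λ : ℂ) * ((d J : ℂ) * w s J + (gs : ℂ) * ∑ K, S J K * w s K)) s) :
    HasDerivAt (fun t J => v t J - w t J)
      (fun J => -(Λ : ℂ) * ((d J : ℂ) * (v s J - w s J) + (gs : ℂ) * ∑ K, S J K * (v s K - w s K))) s := by
  rw [hasDerivAt_pi] at hv hw ⊢
  intro J
  refine ((hv J).sub (hw J)).congr_deriv ?_
  simp only [mul_sub, Finset.sum_sub_distrib]
  ring

omit [DecidableEq ι] in
/-- **Forward uniqueness** for `v' = −Λ(Dv + g S v)` (`S` skew-Hermitian, `Λ > 0`, any real `d`, any `g`): two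
trajectories, continuous on `[a,b]` and solving the system on `(a,b)`, with the same datum at `a` coincide on `[a,b]`.
(Energy of the difference: `E' = −2ΛΣ d_J|u_J|² ≤ 2Λ(Σ_J|d_J|)E`, `E(a) = 0`.)
[cite: KokotovicBensoussanBlankenship1987, Kokotović §2 (linear time-varying systems (2.10)–(2.11))] [folklore] -/
theorem eq_of_eq_init (S : Matrix ι ι ℂ) (d : ι → ℝ) (Λ a b : ℝ) (g : ℝ → ℝ) (v w : ℝ → ι → ℂ)
    (hS : ∀ J K, S K J = -conj (S J K)) (hΛ : 0 < Λ)
    (hvc : ContinuousOn v (Icc a b)) (hwc : ContinuousOn w (Icc a b))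
    (hv : ∀ s ∈ Ioo a b, HasDerivAt v
        (fun J => -(Λ : ℂ) * ((d J : ℂ) * v s J + (g s : ℂ) * ∑ K, S J K * v s K)) s)
    (hw : ∀ s ∈ Ioo a b, HasDerivAt w
        (fun J => -(Λ : ℂ) * ((d J : ℂ) * w s J + (g s : ℂ) * ∑ K, S J K * w s K)) s)
    (hinit : v a = w a) : ∀ s ∈ Icc a b, v s = w s := by
  set u : ℝ → ι → ℂ := fun t J => v t J - w t J with hu
  have huc : ContinuousOn u (Icc a b) := by
    refine continuousOn_pi.2 fun J => ?_
    exact (continuousOn_pi.1 hvc J).sub (continuousOn_pi.1 hwc J)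
  have hud : ∀ s ∈ Ioo a b, HasDerivAt u
      (fun J => -(Λ : ℂ) * ((d J : ℂ) * u s J + (g s : ℂ) * ∑ K, S J K * u s K)) s :=
    fun s hs => hasDerivAt_field_sub S d Λ (g s) v w s (hv s hs) (hw s hs)
  set E : ℝ → ℝ := fun t => ∑ J, ‖u t J‖ ^ 2 with hE
  have hEc : ContinuousOn E (Icc a b) :=
    continuousOn_finsetSum _ fun J _ => (((continuousOn_pi.1 huc J)).norm).pow 2
  have hEa : E a = 0 := by
    simp only [hE, hu, hinit, sub_self, norm_zero]
    simp
  set dm : ℝ := ∑ J, |d J| with hdm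
  have hdJ : ∀ J, -dm ≤ d J := fun J => by
    have h1 : |d J| ≤ dm := Finset.single_le_sum (fun K _ => abs_nonneg (d K)) (Finset.mem_univ J)
    linarith [neg_abs_le (d J)]
  -- `t ↦ exp(−2Λ dm (t − a)) E t` is non-increasing
  have hmono : AntitoneOn (fun t => Real.exp (-(2 * Λ * dm) * (t - a)) * E t) (Icc a b) := by
    have hexp : ∀ t, HasDerivAt (fun t => Real.exp (-(2 * Λ * dm) * (t - a)))
        (Real.exp (-(2 * Λ * dm) * (t - a)) * (-(2 * Λ * dm))) t := by
      intro t
      have := (((hasDerivAt_id t).sub_const a).const_mul (-(2 * Λ * dm))).exp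
      simpa using this
    have hE' : ∀ t ∈ Ioo a b, HasDerivAt E (-2 * Λ * ∑ J, d J * ‖u t J‖ ^ 2) t := fun t ht =>
      hasDerivAt_energy S d Λ (g t) u t hS (hud t ht)
    refine antitoneOn_of_deriv_nonpos (convex_Icc a b) ?_ ?_ ?_
    · exact (Real.continuous_exp.comp (continuous_const.mul (continuous_id.sub continuous_const))
        ).continuousOn.mul hEc
    · rw [interior_Icc]; intro t ht
      exact ((hexp t).mul (hE' t ht)).differentiableAt.differentiableWithinAt
    · rw [interior_Icc]; intro t ht
      have hmul : HasDerivAt (fun t => Real.exp (-(2 * Λ * dm) * (t - a)) * E t)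
          (Real.exp (-(2 * Λ * dm) * (t - a)) * (-(2 * Λ * dm)) * E t +
            Real.exp (-(2 * Λ * dm) * (t - a)) * (-2 * Λ * ∑ J, d J * ‖u t J‖ ^ 2)) t :=
        (hexp t).mul (hE' t ht)
      rw [hmul.deriv]
      have hsum : -dm * E t ≤ ∑ J, d J * ‖u t J‖ ^ 2 := by
        simp only [hE]; rw [Finset.mul_sum]
        exact Finset.sum_le_sum fun J _ => mul_le_mul_of_nonneg_right (hdJ J) (by positivity)
      have hpos : 0 < Real.exp (-(2 * Λ * dm) * (t - a)) := Real.exp_pos _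
      have key : Real.exp (-(2 * Λ * dm) * (t - a)) * (-(2 * Λ * dm)) * E t +
          Real.exp (-(2 * Λ * dm) * (t - a)) * (-2 * Λ * ∑ J, d J * ‖u t J‖ ^ 2) =
          -(2 * (Real.exp (-(2 * Λ * dm) * (t - a)) * Λ * (dm * E t + ∑ J, d J * ‖u t J‖ ^ 2))) := by ring
      rw [key, neg_nonpos]
      exact mul_nonneg (by norm_num) (mul_nonneg (mul_nonneg hpos.le hΛ.le) (by linarith))
  intro s hs
  have hab : a ≤ b := hs.1.trans hs.2
  have h := hmono (left_mem_Icc.2 hab) hs hs.1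
  simp only [sub_self, mul_zero, Real.exp_zero, hEa] at h
  have hEs : E s ≤ 0 := by
    have hpos : 0 < Real.exp (-(2 * Λ * dm) * (s - a)) := Real.exp_pos _
    nlinarith [h, hpos]
  have hE0 : E s = 0 := le_antisymm hEs (Finset.sum_nonneg fun J _ => by positivity)
  funext J
  have : ‖u s J‖ ^ 2 = 0 := by
    have hle : ‖u s J‖ ^ 2 ≤ E s := by
      simp only [hE]
      exact Finset.single_le_sum (f := fun K => ‖u s K‖ ^ 2) (fun K _ => by positivity) (Finset.mem_univ J)
    exact le_antisymm (by rw [hE0] at hle; exact hle) (by positivity)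
  have : u s J = 0 := by simpa using this
  simpa [hu, sub_eq_zero] using this

omit [DecidableEq ι] in
/-- **Superposition**: if `v`, `v¹`, `v²` are trajectories on `[a,b]` with `v(a) = v¹(a) + v²(a)` then
`v = v¹ + v²` on `[a,b]` — e.g. `v¹` the slow column (`v¹(a) = v_o(a) e_o`) and `v²` the fast part, to which the
column law (§3–§6) and the off-cone bounds (§7) apply separately. [folklore]
[cite: KokotovicBensoussanBlankenship1987, Kokotović §2 (2.19)–(2.20) (exact slow/fast decomposition)] -/
theorem eq_add_of_init (S : Matrix ι ι ℂ) (d : ι → ℝ) (Λ a b : ℝ) (g : ℝ → ℝ) (v v₁ v₂ : ℝ → ι → ℂ)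
    (hS : ∀ J K, S K J = -conj (S J K)) (hΛ : 0 < Λ)
    (hvc : ContinuousOn v (Icc a b)) (h1c : ContinuousOn v₁ (Icc a b)) (h2c : ContinuousOn v₂ (Icc a b))
    (hv : ∀ s ∈ Ioo a b, HasDerivAt v
        (fun J => -(Λ : ℂ) * ((d J : ℂ) * v s J + (g s : ℂ) * ∑ K, S J K * v s K)) s)
    (h1 : ∀ s ∈ Ioo a b, HasDerivAt v₁
        (fun J => -(Λ : ℂ) * ((d J : ℂ) * v₁ s J + (g s : ℂ) * ∑ K, S J K * v₁ s K)) s)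
    (h2 : ∀ s ∈ Ioo a b, HasDerivAt v₂
        (fun J => -(Λ : ℂ) * ((d J : ℂ) * v₂ s J + (g s : ℂ) * ∑ K, S J K * v₂ s K)) s)
    (hinit : v a = fun J => v₁ a J + v₂ a J) : ∀ s ∈ Icc a b, v s = fun J => v₁ s J + v₂ s J := by
  set w : ℝ → ι → ℂ := fun t J => v₁ t J + v₂ t J with hw
  have hwc : ContinuousOn w (Icc a b) :=
    continuousOn_pi.2 fun J => (continuousOn_pi.1 h1c J).add (continuousOn_pi.1 h2c J)
  have hwd : ∀ s ∈ Ioo a b, HasDerivAt w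
      (fun J => -(Λ : ℂ) * ((d J : ℂ) * w s J + (g s : ℂ) * ∑ K, S J K * w s K)) s := by
    intro s hs
    rw [hasDerivAt_pi]
    intro J
    have := ((hasDerivAt_pi.1 (h1 s hs)) J).add ((hasDerivAt_pi.1 (h2 s hs)) J)
    refine this.congr_deriv ?_
    simp only [hw, mul_add, Finset.sum_add_distrib]
    ring
  exact eq_of_eq_init S d Λ a b g v w hS hΛ hvc hwc hv hwd (by rw [hinit])

/-! ## §9 Real structure: conjugation symmetry, reality of trajectories, positivity of the slow column

When the couplings are REAL (`conj (S J K) = S J K`; with skewness: `S` real antisymmetric — the gauged three-term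
ladders), complex conjugation maps trajectories to trajectories, so real data stay real (uniqueness, §8), the
propagator is a real matrix, and the slow entry of the real column `e_o` is real and — since it never vanishes
(§3) — POSITIVE: the slot multiplier is `‖v_o(t)‖/‖v_o(a)‖`, with no phase. [folklore] -/

omit [DecidableEq ι] in
/-- Conjugation symmetry: for REAL couplings, `t ↦ conj ∘ v t` solves the same system. [folklore] -/
private theorem hasDerivAt_field_conj (S : Matrix ι ι ℂ) (d : ι → ℝ) (Λ gs : ℝ) (v : ℝ → ι → ℂ) (s : ℝ)
    (hSreal : ∀ J K, conj (S J K) = S J K)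
    (hv : HasDerivAt v (fun J => -(Λ : ℂ) * ((d J : ℂ) * v s J + (gs : ℂ) * ∑ K, S J K * v s K)) s) :
    HasDerivAt (fun t J => conj (v t J))
      (fun J => -(Λ : ℂ) * ((d J : ℂ) * conj (v s J) + (gs : ℂ) * ∑ K, S J K * conj (v s K))) s := by
  rw [hasDerivAt_pi] at hv ⊢
  intro J
  refine ((hv J).star).congr_deriv ?_
  change conj (-(Λ : ℂ) * ((d J : ℂ) * v s J + (gs : ℂ) * ∑ K, S J K * v s K)) = _
  simp only [map_neg, map_mul, map_add, map_sum, Complex.conj_ofReal, hSreal]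

omit [DecidableEq ι] in
/-- **Real data stay real** (real couplings): if `conj (v_J(a)) = v_J(a)` for all `J`, then `conj (v_J(s)) = v_J(s)`
on `[a,b]` (the transition matrix of a real linear time-varying system is real). [folklore]
[cite: KokotovicBensoussanBlankenship1987, Kokotović §2 (2.10)–(2.11), (2.19)–(2.20) (real coefficient and transition matrices)] -/
theorem conj_eq_of_conj_init (S : Matrix ι ι ℂ) (d : ι → ℝ) (Λ a b : ℝ) (g : ℝ → ℝ) (v : ℝ → ι → ℂ)
    (hS : ∀ J K, S K J = -conj (S J K)) (hSreal : ∀ J K, conj (S J K) = S J K) (hΛ : 0 < Λ)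
    (hcont : ContinuousOn v (Icc a b))
    (hderiv : ∀ s ∈ Ioo a b, HasDerivAt v
        (fun J => -(Λ : ℂ) * ((d J : ℂ) * v s J + (g s : ℂ) * ∑ K, S J K * v s K)) s)
    (hinit : ∀ J, conj (v a J) = v a J) : ∀ s ∈ Icc a b, ∀ J, conj (v s J) = v s J := by
  have hcc : ContinuousOn (fun t J => conj (v t J)) (Icc a b) :=
    continuousOn_pi.2 fun J => Complex.continuous_conj.comp_continuousOn (continuousOn_pi.1 hcont J)
  have hcd : ∀ s ∈ Ioo a b, HasDerivAt (fun t J => conj (v t J))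
      (fun J => -(Λ : ℂ) * ((d J : ℂ) * conj (v s J) + (g s : ℂ) * ∑ K, S J K * conj (v s K))) s :=
    fun s hs => hasDerivAt_field_conj S d Λ (g s) v s hSreal (hderiv s hs)
  have key := eq_of_eq_init S d Λ a b g (fun t J => conj (v t J)) v hS hΛ hcc hcont hcd hderiv
    (funext fun J => hinit J)
  intro s hs J
  exact congrFun (key s hs) J

/-- **Positivity of the slow entry of the real column.** Real couplings, gap, coupling bound and cone radius as in
`slowCone_invariant`; a datum with REAL entries, positive slow entry `v_o(a) = ‖v_o(a)‖ > 0` and fast part strictly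
inside the cone. Then `v_o(s)` is real and positive on `[a,b]`: `v_o(s) = ‖v_o(s)‖` — the slot multiplier has no phase,
and `abs_log_slowEnergy_expansion_le` determines it completely. [folklore]
[cite: KokotovicBensoussanBlankenship1987, Kokotović §2 (2.19)–(2.20) (real slow/fast propagators)] -/
theorem slow_eq_norm_of_real (S : Matrix ι ι ℂ) (d : ι → ℝ) (o : ι) (Λ gT Δ γ R a b : ℝ) (g : ℝ → ℝ)
    (v : ℝ → ι → ℂ) (hS : ∀ J K, S K J = -conj (S J K)) (hSreal : ∀ J K, conj (S J K) = S J K)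
    (hγ : γ ^ 2 = ∑ K ∈ univ.erase o, ‖S o K‖ ^ 2) (hγ0 : 0 ≤ γ)
    (hΔ : ∀ J, J ≠ o → d o + Δ ≤ d J) (hΛ : 0 < Λ)
    (hg : ∀ s ∈ Ioo a b, |g s| ≤ gT) (hR : 0 < R) (htrap : gT * γ * (1 + R ^ 2) < Δ * R)
    (hcont : ContinuousOn v (Icc a b))
    (hderiv : ∀ s ∈ Ioo a b, HasDerivAt v
        (fun J => -(Λ : ℂ) * ((d J : ℂ) * v s J + (g s : ℂ) * ∑ K, S J K * v s K)) s)
    (hreal : ∀ J, conj (v a J) = v a J) (hpos : 0 < (v a o).re)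
    (hinit : ∑ J ∈ univ.erase o, ‖v a J‖ ^ 2 < R ^ 2 * ‖v a o‖ ^ 2) :
    ∀ s ∈ Icc a b, v s o = ((‖v s o‖ : ℝ) : ℂ) := by
  have hcone := slowCone_invariant S d o Λ gT Δ γ R a b g v hS hγ hγ0 hΔ hΛ hg hR htrap hcont hderiv hinit
  have hrealAll := conj_eq_of_conj_init S d Λ a b g v hS hSreal hΛ hcont hderiv hreal
  -- the real part of `v_o` is continuous, never zero, positive at `a`: positive throughout
  have him : ∀ s ∈ Icc a b, (v s o).im = 0 := fun s hs => by
    have h := hrealAll s hs o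
    have := congrArg Complex.im h
    rw [Complex.conj_im] at this
    linarith
  have hre_ne : ∀ s ∈ Icc a b, (v s o).re ≠ 0 := by
    intro s hs h0
    have hz : v s o = 0 := Complex.ext h0 (him s hs)
    exact (ne_of_gt (hcone s hs).2) (by rw [hz, norm_zero])
  have hrec : ContinuousOn (fun t => (v t o).re) (Icc a b) :=
    Complex.continuous_re.comp_continuousOn (continuousOn_pi.1 hcont o)
  have hre_pos : ∀ s ∈ Icc a b, 0 < (v s o).re := by
    intro s hs
    by_contra hneg
    rw [not_lt] at hneg
    -- IVT on `[a, s]` gives a zero of the real part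
    have hsub : Icc a s ⊆ Icc a b := Icc_subset_Icc le_rfl hs.2
    have hivt := intermediate_value_Icc' hs.1 (hrec.mono hsub)
    have h0mem : (0 : ℝ) ∈ Icc ((v s o).re) ((v a o).re) := ⟨hneg, hpos.le⟩
    obtain ⟨c, hc, hc0⟩ := hivt h0mem
    exact hre_ne c (hsub hc) hc0
  intro s hs
  apply Complex.ext
  · rw [Complex.ofReal_re]
    have h1 : ‖v s o‖ = |(v s o).re| := by
      rw [← Complex.abs_re_eq_norm.2 (him s hs)]
    rw [h1, abs_of_pos (hre_pos s hs)]
  · rw [Complex.ofReal_im]; exact him s hs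

end Setting

end Literature.Analysis.ODE
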